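import Literature.LinearAlgebra.Matrix.StieltjesMatrixProofs
import Literature.LinearAlgebra.Matrix.ZMatrixDiagonalStability
import Literature.MathematicalPhysics.PowerSystems.PhaseCohesiveEquilibriumUniqueness
import HarnessLib

/-!
# Quadratic droop control of inverter voltages (Simpson-Porco–Dörfler–Bullo 2017): the closed
# loop, the reduced power flow equation (Theorem 3.1), and existence / uniqueness / stability of
# the high-voltage solution for ZI loads (Theorem 3.3)

Topic `Literature/MathematicalPhysics/PowerSystems` (LADDER-GRIDFUSION rung G3.b «droop microgrid
with Q–V dynamics»; seat gridfusion-lit-2, g11).  The VOLTAGE side of inverter droop control: the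
tree's `DroopControlledInverters.lean` / `DAPISecondaryControlStability*.lean` type the
frequency/active-power results of Simpson-Porco–Dörfler–Bullo 2013; this file types the companion
paper on reactive power / voltage magnitudes [SimpsonporcoDorflerBullo2017] (IEEE TAC 62 (2017)
1239–1253 = arXiv:1507.00431, held text read on the page this session).

THE MODEL (§2.1, §3.1 of the source).  Buses `V = L ∪ I` (`n` loads, `m` inverters), susceptance
matrix `B ∈ ℝ^{(n+m)×(n+m)}`, decoupled reactive power flow `Q_e(E) = −[E]BE` (p0006:
«`|θ_i − θ_j| ≈ 0`»), inverters `τ_iĖ_i = u_i` with the QUADRATIC DROOP CONTROLLER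
`u_i = K_iE_i(E_i − E_i*) − Q_e,i(E)` (eq. (3.1), `K_i < 0`), loads `0 = Q_i(E_i) − Q_e,i(E)`; the
closed loop is the differential-algebraic system (3.3)
`[0; τ_IĖ_I] = [Q_L(E_L); [E_I]K_I(E_I − E_I*)] + [E]BE`.  Reduced quantities (3.4)–(3.6):
`B_red = B_LL − B_LI(B_II + K_I)⁻¹B_IL`, `W₂ = (B_II + K_I)⁻¹(−B_IL, K_I)`, `E_L* = W₁E_I*`.

WHAT IS PROVED (0 named facts, no `sorry`):
* §1 the record `QuadDroopNetwork n m`, `closedLoop` (3.3), `IsEquilibrium`, `IsSolutionAt`, the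
  blocks, `BIIK = B_II + K_I`, `Bred`, `redSource = B_redE_L*` (spelled without inverting `B_red`),
  `invVoltage = W₂(E_L, E_I*)`, `ReducedPowerFlow` (3.7);
* §2 **`isEquilibrium_iff_reducedPowerFlow`** = THEOREM 3.1: for positive inverter voltages and
  `B_II + K_I` invertible, `E` is an equilibrium of (3.3) iff `E_L` solves
  `0 = Q_L(E_L) + [E_L]B_red(E_L − E_L*)` and `E_I = W₂(E_L, E_I*)`;
* §3 THEOREM 3.3 (ZI loads `Q_L^{ZI} = [E_L][b_shunt]E_L + [E_L]I_shunt`): with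
  (i) `−(B_red + [b_shunt])` a Stieltjes matrix (the print's «`M`-matrix»: symmetric positive
  definite with nonpositive off-diagonal entries, [BermanPlemmons1994, Ch. 6 Ex. 2.6]) and
  (ii) `I_shunt > B_redE_L*` componentwise — **`ziVoltage_pos`** (`E_L^{ZI} ∈ ℝ^n_{>0}`, via the
  tree's `posDef_isZMatrix_inv_nonneg`), **`ziVoltage_reducedPowerFlow`** (it solves (3.7)),
  **`eq_ziVoltage_of_reducedPowerFlow`** (uniqueness among states with nonvanishing load
  voltages), `jacRed` (3.9), **`jacRed_ziVoltage`** (`J_red(E_L^{ZI}) = [E_L^{ZI}](B_red + [b_shunt])`,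
  (3.13)), **`jacRed_ziVoltage_isHurwitz`** («Hurwitz since … `M`-matrices are `D`-stable», via
  the tree's `IsZMatrix.isHurwitz_neg_of_semipositive`), assembled as **`theorem_3_3_ziLoads`**;
* §4 PROPOSITION 7.2 (i): **`isZMatrix_neg_Bred`** (off-diagonal entries of `B` nonnegative and
  `−(B_II + K_I)` Stieltjes ⇒ `−B_red` is a Z-matrix, by inverse-positivity of `−(B_II + K_I)`),
  `Bred_transpose`, **`posDef_neg_Bred`** (`B` symmetric and `−(B + blkdiag(0, K_I))` positive
  definite ⇒ `−B_red` positive definite: the Schur complement, Mathlib's `schur_complement_eq₂₂`),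
  **`stieltjes_neg_Bred`** («`−B_red` is an `M`-matrix»; the sign pattern survives adding `[b_shunt]`);
* §5 PROPOSITION 7.2 (ii)–(iii): the averaging matrices `W1 = −B_red⁻¹B_LI(B_II + K_I)⁻¹K_I`,
  `W2 = (B_II + K_I)⁻¹(−B_IL  K_I)` and `ELstar = W₁E_I*` (3.5)–(3.6); `Bred_mulVec_ELstar`
  (`B_redE_L* = redSource`), `invVoltage_eq_W2_mulVec` (`E_I = W₂(E_L, E_I*)`),
  `reducedPowerFlow_iff_ELstar`; **`W2_mulVec_one`**, **`W2_nonneg`**, **`W1_mulVec_one`**,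
  **`W1_nonneg`** (row-stochastic, from `B𝟙 = 0`, the sign pattern of `B` and the
  inverse-positivity of the two Stieltjes matrices), **`ELstar_pos`** (`E_L* > 0`: a convex
  combination of the `E_i* > 0`), assembled as **`proposition_7_2`** under Lemma 7.1-type
  hypotheses (`B` symmetric, off-diagonal `≥ 0`, zero row sums, `−(B + blkdiag(0, K_I))` positive
  definite, `K_i ≤ 0`, `E_i* > 0`);
* §6 back in the ORIGINAL network: **`isEquilibrium_of_reducedPowerFlow`** (Theorem 3.1
  (ii) ⇒ (i) with no sign condition: `(E_L, W₂(E_L, E_I*))` is an equilibrium of (3.3)),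
  **`invVoltage_pos`** (`W₂` row-stochastic ⇒ recovered inverter voltages positive), `ziState`
  = `(E_L^{ZI}, E_I^{ZI})` and **`theorem_3_3_originalNetwork`**: under the data hypotheses of
  Proposition 7.2 and (i)–(ii) of Theorem 3.3, `(E_L^{ZI}, E_I^{ZI})` is an equilibrium of the
  closed loop with ZI loads, lies in `ℝ^{n+m}_{>0}`, `E_L^{ZI}` is the unique positive reduced
  solution, and `J_red(E_L^{ZI})` is Hurwitz.
* §7 LEMMA 7.1 (Properties of Susceptance Matrix) from NETWORK DATA: `susceptanceMatrix w` = the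
  susceptance matrix of an inductive network with branch susceptance magnitudes `w_ij = 1/X_ij ≥ 0`
  (symmetric; `B_ij = w_ij` off the diagonal, `B_ii = −Σ_{j≠i} w_ij`), `BranchConnected w` (cut form
  of «connected», the general-index twin of `ClassicalModel.CouplingConnected`):
  **(i)** `susceptanceMatrix_apply_ne` / `_isSymm` / `_offDiag_nonneg` / `_offDiag_pos_iff`;
  **(ii)** `sum_susceptanceMatrix_row` (`B𝟙 = 0`), `dotProduct_susceptanceMatrix_mulVec`
  (`xᵀBx = −½ΣΣ w_ij(x_i − x_j)²`), `posSemidef_neg_susceptanceMatrix`,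
  `susceptanceMatrix_mulVec_eq_zero_iff` (connected ⇒ `ker B = ℝ𝟙`); **(iii)**
  `posDef_neg_susceptanceMatrix_submatrix` (proper principal submatrices of `B` negative definite);
  and the consequences the rest of the file takes as hypotheses: `posDef_neg_aug_of_branchConnected`
  (`−(B + blkdiag(0, K_I)) ≻ 0` for `K_i < 0`, `m ≥ 1`), **`theorem_3_3_of_network`** (Theorem 3.3 in
  the original network from: connected inductive network, `K_i < 0`, `E_i* > 0`, `m ≥ 1`,
  (i) `−(B_red + [b_shunt]) ≻ 0` — its Z-sign pattern being automatic —, (ii) `I_shunt > B_redE_L*`).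

THREE COLUMNS.  Statements about the MODEL «decoupled reactive power flow + first-order inverter
voltage sources under quadratic droop + static ZI loads»: lossless/decoupled approximation, no
frequency dynamics, no inner loops.  NOT typed here: Theorem 3.2 (local exponential stability of
the DAE equilibrium from the Hurwitz reduced Jacobian — needs the DAE linearisation of [RR:04]) and
its sufficient condition (3.10) (both typed in the sequel `QuadraticDroopReducedJacobianStability.lean`);
in §1–§6 the susceptance-matrix properties enter as hypotheses (symmetry, nonnegative off-diagonal
entries, zero row sums, `−(B + blkdiag(0, K_I))` positive definite) and §7 derives them from network
data (Lemma 7.1; the «simple eigenvalue» clause is typed as `ker B = ℝ𝟙`); in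
Theorem 3.3 the Stieltjes property of `−(B_red + [b_shunt])` is a hypothesis as printed («assume
(i)»; a finite check on data, its Z-part automatic by §4); Theorems 3.4–3.5 (ZIP / dynamic shunt
loads), §4 of the source (power sharing, quadratic optimisation).  Nothing here says a microgrid is
stable.

## Mathlib / tree search

Tree (used by name): `Literature.LinearAlgebra.Matrix.{IsZMatrix, posDef_isZMatrix_inv_nonneg
(StieltjesMatrixProofs), semipositive_of_inv_nonneg (ZMatrixSemipositive),
IsZMatrix.isHurwitz_neg_of_semipositive (ZMatrixDiagonalStability)}`,
`Literature.MathematicalPhysics.KineticTheory.HeatConduction.IsHurwitz`.  Summits-side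
`GridStability/Models/DroopQVData.lean` (conventional droop + Q–V census data) is a different model
(linear droop); not imported (Literature cannot import Summits).

## References

* J. W. Simpson-Porco, F. Dörfler, F. Bullo, *Voltage stabilization in microgrids via quadratic droop
  control*, IEEE Trans. Automat. Control 62 (2017) 1239–1253 = arXiv:1507.00431, §2.1, §3.1 eqs.
  (3.1)–(3.3), §2.1 (network model: «connected and weighted graph», `Y_ij = −y_ij`, `Y_ii = Σ_{j≠i} y_ij`,
  «For dominantly inductive lines … `Y = jB`», p0006), §3.2 Theorems 3.1–3.2 (held text p0009
  L36–p0010 L30), §3.3 Theorem 3.3 (p0011 L10–L60), §7 Lemma 7.1 (p0019 L3–L9) / Proposition 7.2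
  (p0019). [SimpsonporcoDorflerBullo2017]
* A. Berman, R. J. Plemmons, *Nonnegative Matrices in the Mathematical Sciences*, SIAM (1994), Ch. 6
  Thm. 2.3 ((N₃₈), (I₂₇) ⇒ (G₂₀)), Def. 2.5, Ex. 2.6. [BermanPlemmons1994]

AI-produced formalisation (LADDER-GRIDFUSION seat gridfusion-lit-2 g11, 2026-08-28).
-/

noncomputable section

open Finset
open scoped Matrix BigOperators

namespace Literature.MathematicalPhysics.PowerSystems

open _root_.Matrix Literature.LinearAlgebra.Matrix
open Literature.MathematicalPhysics.KineticTheory.HeatConduction (IsHurwitz)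

/-- **Data of a quadratic-droop-controlled microgrid** (decoupled reactive power flow): `n` load
buses (indices `Sum.inl`) and `m` inverter buses (`Sum.inr`), the susceptance matrix `B` of the
network, the quadratic droop gains `K_i` (`K_i < 0` in the print), the inverter voltage set points
`E_i* > 0` and the inverter time constants `τ_i > 0`.
[cite: SimpsonporcoDorflerBullo2017, §2.1 (network, `Q = −[E]BE`), §2.1 eq. (2.5) (`τ_iĖ_i = u_i`), §3.1 eq. (3.1) (`u_i = K_iE_i(E_i − E_i*) − Q_e,i(E)`)] -/
structure QuadDroopNetwork (n m : ℕ) where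
  /-- the susceptance matrix `B ∈ ℝ^{(n+m)×(n+m)}` (loads first, inverters last) -/
  B : Matrix (Fin n ⊕ Fin m) (Fin n ⊕ Fin m) ℝ
  /-- the quadratic droop gains `K_i` -/
  K : Fin m → ℝ
  /-- the inverter voltage set points `E_i*` -/
  Estar : Fin m → ℝ
  /-- the inverter time constants `τ_i` -/
  τ : Fin m → ℝ

namespace QuadDroopNetwork

variable {n m : ℕ} (W : QuadDroopNetwork n m)

/-! ## §1 The closed loop, its equilibria, the blocks of `B` and the reduced quantities -/

/-- The reactive power injection under the decoupling assumption: `Q_e,k(E) = −E_k Σ_j B_kj E_j`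
(`Q = −[E]BE`). [cite: SimpsonporcoDorflerBullo2017, §2.1 eqs. (2.3)–(2.4)] -/
def reactiveInjection (E : Fin n ⊕ Fin m → ℝ) (k : Fin n ⊕ Fin m) : ℝ := -(E k * (W.B *ᵥ E) k)

/-- **The closed loop (3.3)** as a right-hand side on `ℝ^{n+m}`: at a load bus the algebraic power
balance residual `Q_l(E_l) + E_l(BE)_l` (`0 = Q_l(E_l) − Q_e,l(E)`), at an inverter bus
`τ_iĖ_i = E_iK_i(E_i − E_i*) + E_i(BE)_i` (`u_i = K_iE_i(E_i − E_i*) − Q_e,i(E)`); `QL` is the static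
load model `Q_l(E_l)`.
[cite: SimpsonporcoDorflerBullo2017, §3.1 eq. (3.3) (`[0; τ_IĖ_I] = [Q_L(E_L); [E_I]K_I(E_I − E_I*)] + [E]BE`)] -/
def closedLoop (QL : Fin n → ℝ → ℝ) (E : Fin n ⊕ Fin m → ℝ) : Fin n ⊕ Fin m → ℝ :=
  Sum.elim (fun l => QL l (E (Sum.inl l)) + E (Sum.inl l) * (W.B *ᵥ E) (Sum.inl l))
    (fun i => E (Sum.inr i) * W.K i * (E (Sum.inr i) - W.Estar i) + E (Sum.inr i) * (W.B *ᵥ E) (Sum.inr i))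

/-- Equilibria of the closed loop (3.3): both blocks of the right-hand side vanish.
[cite: SimpsonporcoDorflerBullo2017, §3.2 Theorem 3.1 (i) and eq. (3.9)] -/
def IsEquilibrium (QL : Fin n → ℝ → ℝ) (E : Fin n ⊕ Fin m → ℝ) : Prop := W.closedLoop QL E = 0

/-- Solutions of the differential-algebraic closed loop (3.3) at time `t`: the load rows hold
algebraically and `τ_iĖ_i` equals the inverter rows.
[cite: SimpsonporcoDorflerBullo2017, §3.1 eq. (3.3) («the closed-loop dynamical system is differential-algebraic»)] -/
def IsSolutionAt (QL : Fin n → ℝ → ℝ) (E : ℝ → Fin n ⊕ Fin m → ℝ) (t : ℝ) : Prop :=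
  (∀ l, W.closedLoop QL (E t) (Sum.inl l) = 0) ∧
    ∀ i, HasDerivAt (fun s => E s (Sum.inr i)) (W.closedLoop QL (E t) (Sum.inr i) / W.τ i) t

/-- The block `B_LL`. [cite: SimpsonporcoDorflerBullo2017, §3.2 (partition of `B`)] -/
def BLL : Matrix (Fin n) (Fin n) ℝ := W.B.toBlocks₁₁
/-- The block `B_LI`. [cite: SimpsonporcoDorflerBullo2017, §3.2] -/
def BLI : Matrix (Fin n) (Fin m) ℝ := W.B.toBlocks₁₂
/-- The block `B_IL`. [cite: SimpsonporcoDorflerBullo2017, §3.2] -/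
def BIL : Matrix (Fin m) (Fin n) ℝ := W.B.toBlocks₂₁
/-- The block `B_II`. [cite: SimpsonporcoDorflerBullo2017, §3.2] -/
def BII : Matrix (Fin m) (Fin m) ℝ := W.B.toBlocks₂₂

/-- `B_II + K_I`. [cite: SimpsonporcoDorflerBullo2017, §3.2 eq. (3.4)] -/
def BIIK : Matrix (Fin m) (Fin m) ℝ := W.BII + diagonal W.K

/-- **The reduced susceptance matrix** `B_red = B_LL − B_LI(B_II + K_I)⁻¹B_IL` (Kron reduction of the
network augmented by the controller susceptances `K_i`).
[cite: SimpsonporcoDorflerBullo2017, §3.2 eq. (3.4)] -/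
def Bred : Matrix (Fin n) (Fin n) ℝ := W.BLL - W.BLI * W.BIIK⁻¹ * W.BIL

/-- The vector `B_redE_L* = −B_LI(B_II + K_I)⁻¹K_IE_I*` (`E_L* = W₁E_I*`,
`W₁ = −B_red⁻¹B_LI(B_II + K_I)⁻¹K_I`), written without inverting `B_red`.
[cite: SimpsonporcoDorflerBullo2017, §3.2 eqs. (3.4)–(3.6) and proof of Theorem 3.1] -/
def redSource : Fin n → ℝ := -((W.BLI * W.BIIK⁻¹) *ᵥ (diagonal W.K *ᵥ W.Estar))

/-- The inverter voltages recovered from the load voltages: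
`E_I = W₂(E_L, E_I*) = (B_II + K_I)⁻¹(K_IE_I* − B_ILE_L)`.
[cite: SimpsonporcoDorflerBullo2017, §3.2 eq. (3.4) (`W₂`) and Theorem 3.1 eq. (3.8)] -/
def invVoltage (EL : Fin n → ℝ) : Fin m → ℝ := W.BIIK⁻¹ *ᵥ (diagonal W.K *ᵥ W.Estar - W.BIL *ᵥ EL)

/-- **The reduced power flow equation** `0 = Q_L(E_L) + [E_L]B_red(E_L − E_L*)`, componentwise,
with `B_redE_L*` spelled `redSource`. [cite: SimpsonporcoDorflerBullo2017, §3.2 Theorem 3.1 eq. (3.7)] -/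
def ReducedPowerFlow (QL : Fin n → ℝ → ℝ) (EL : Fin n → ℝ) : Prop :=
  ∀ l, QL l (EL l) + EL l * ((W.Bred *ᵥ EL) l - W.redSource l) = 0

variable {W}

/-- `B` is the block matrix of its four blocks. [folklore] -/
private theorem B_eq_fromBlocks : W.B = Matrix.fromBlocks W.BLL W.BLI W.BIL W.BII :=
  (Matrix.fromBlocks_toBlocks W.B).symm

/-- Load rows of `BE`. [folklore] -/
private theorem B_mulVec_inl (E : Fin n ⊕ Fin m → ℝ) (l : Fin n) :
    (W.B *ᵥ E) (Sum.inl l)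
      = (W.BLL *ᵥ fun l' => E (Sum.inl l')) l + (W.BLI *ᵥ fun i => E (Sum.inr i)) l := by
  conv_lhs => rw [B_eq_fromBlocks, Matrix.fromBlocks_mulVec]
  rfl

/-- Inverter rows of `BE`. [folklore] -/
private theorem B_mulVec_inr (E : Fin n ⊕ Fin m → ℝ) (i : Fin m) :
    (W.B *ᵥ E) (Sum.inr i)
      = (W.BIL *ᵥ fun l' => E (Sum.inl l')) i + (W.BII *ᵥ fun i' => E (Sum.inr i')) i := by
  conv_lhs => rw [B_eq_fromBlocks, Matrix.fromBlocks_mulVec]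
  rfl

/-! ## §2 Theorem 3.1: equilibria of the closed loop ⇔ solutions of the reduced power flow equation -/

/-- The inverter rows at a state with positive inverter voltages: they vanish iff
`(B_II + K_I)E_I = K_IE_I* − B_ILE_L`. [cite: SimpsonporcoDorflerBullo2017, proof of Theorem 3.1 («left-multiply the lower block … by `[E_I]⁻¹`»)] -/
theorem inverterRows_eq_zero_iff (QL : Fin n → ℝ → ℝ) {E : Fin n ⊕ Fin m → ℝ}
    (hE : ∀ i, 0 < E (Sum.inr i)) :
    (∀ i, W.closedLoop QL E (Sum.inr i) = 0) ↔
      W.BIIK *ᵥ (fun i => E (Sum.inr i))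
        = diagonal W.K *ᵥ W.Estar - W.BIL *ᵥ fun l => E (Sum.inl l) := by
  constructor
  · intro h
    funext i
    have hi := h i
    simp only [closedLoop, Sum.elim_inr, B_mulVec_inr] at hi
    have hfac : E (Sum.inr i) * (W.K i * (E (Sum.inr i) - W.Estar i)
        + ((W.BIL *ᵥ fun l' => E (Sum.inl l')) i + (W.BII *ᵥ fun i' => E (Sum.inr i')) i)) = 0 := by
      rw [← hi]; ring
    have hzero := (mul_eq_zero.1 hfac).resolve_left (hE i).ne'
    simp only [BIIK, Matrix.add_mulVec, Pi.add_apply, Pi.sub_apply, Matrix.mulVec_diagonal]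
    linarith
  · intro h i
    have hi := congrFun h i
    simp only [BIIK, Matrix.add_mulVec, Pi.add_apply, Pi.sub_apply, Matrix.mulVec_diagonal] at hi
    simp only [closedLoop, Sum.elim_inr, B_mulVec_inr]
    have : W.K i * (E (Sum.inr i) - W.Estar i)
        + ((W.BIL *ᵥ fun l' => E (Sum.inl l')) i + (W.BII *ᵥ fun i' => E (Sum.inr i')) i) = 0 := by
      linarith
    calc E (Sum.inr i) * W.K i * (E (Sum.inr i) - W.Estar i)
          + E (Sum.inr i) * ((W.BIL *ᵥ fun l' => E (Sum.inl l')) i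
            + (W.BII *ᵥ fun i' => E (Sum.inr i')) i)
        = E (Sum.inr i) * (W.K i * (E (Sum.inr i) - W.Estar i)
          + ((W.BIL *ᵥ fun l' => E (Sum.inl l')) i + (W.BII *ᵥ fun i' => E (Sum.inr i')) i)) := by
          ring
      _ = 0 := by rw [this, mul_zero]

/-- With `E_I = W₂(E_L, E_I*)` the load rows of `BE` are `B_redE_L − B_redE_L*`.
[cite: SimpsonporcoDorflerBullo2017, proof of Theorem 3.1 («Substituting (3.8) into the first block … `[E_L]B_red(E_L − E_L^*)`»)] -/
theorem loadRow_of_invVoltage (EL : Fin n → ℝ) (l : Fin n) :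
    (W.BLL *ᵥ EL) l + (W.BLI *ᵥ W.invVoltage EL) l = (W.Bred *ᵥ EL) l - W.redSource l := by
  have h1 : W.BLI *ᵥ W.invVoltage EL
      = (W.BLI * W.BIIK⁻¹) *ᵥ (diagonal W.K *ᵥ W.Estar) - (W.BLI * W.BIIK⁻¹ * W.BIL) *ᵥ EL := by
    simp only [invVoltage, Matrix.mulVec_sub, Matrix.mulVec_mulVec, Matrix.mul_assoc]
  rw [h1, Bred, redSource, Matrix.sub_mulVec]
  simp only [Pi.sub_apply, Pi.neg_apply]
  ring

/-- **Theorem 3.1 (Reduced Power Flow Equation for Quadratic Droop Network).**  For a state `E`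
with positive inverter voltages and `B_II + K_I` invertible: `E` is an equilibrium of the closed loop
(3.3) IFF its load part `E_L` solves the reduced power flow equation
`0 = Q_L(E_L) + [E_L]B_red(E_L − E_L*)` AND its inverter part is recovered as
`E_I = W₂(E_L, E_I*) = (B_II + K_I)⁻¹(K_IE_I* − B_ILE_L)`.  (The print assumes `E ∈ ℝ^{n+m}_{>0}`;
only `E_I > 0` is used; invertibility of `B_II + K_I` is part of Proposition 7.2, here a
hypothesis — e.g. from `−(B_II + K_I)` positive definite, `isUnit_BIIK_det_of_posDef`.)
[cite: SimpsonporcoDorflerBullo2017, §3.2 Theorem 3.1 («The following two statements are equivalent: (i) Original Network … (ii) Reduced Network …», eqs. (3.7)–(3.8)) and its proof] -/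
theorem isEquilibrium_iff_reducedPowerFlow (hU : IsUnit W.BIIK.det) (QL : Fin n → ℝ → ℝ)
    {E : Fin n ⊕ Fin m → ℝ} (hE : ∀ i, 0 < E (Sum.inr i)) :
    W.IsEquilibrium QL E ↔
      W.ReducedPowerFlow QL (fun l => E (Sum.inl l)) ∧
        (fun i => E (Sum.inr i)) = W.invVoltage fun l => E (Sum.inl l) := by
  have hinv : (∀ i, W.closedLoop QL E (Sum.inr i) = 0) ↔
      (fun i => E (Sum.inr i)) = W.invVoltage fun l => E (Sum.inl l) := by
    rw [inverterRows_eq_zero_iff QL hE, invVoltage]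
    constructor
    · intro h
      rw [← h, Matrix.mulVec_mulVec, Matrix.nonsing_inv_mul _ hU, Matrix.one_mulVec]
    · intro h
      rw [h, Matrix.mulVec_mulVec, Matrix.mul_nonsing_inv _ hU, Matrix.one_mulVec]
  have hsplit : W.IsEquilibrium QL E ↔
      (∀ l, W.closedLoop QL E (Sum.inl l) = 0) ∧ ∀ i, W.closedLoop QL E (Sum.inr i) = 0 := by
    constructor
    · intro h
      exact ⟨fun l => congrFun h (Sum.inl l), fun i => congrFun h (Sum.inr i)⟩
    · rintro ⟨h1, h2⟩
      funext k
      cases k with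
      | inl l => exact h1 l
      | inr i => exact h2 i
  rw [hsplit, hinv]
  constructor
  · rintro ⟨hL, hI⟩
    refine ⟨fun l => ?_, hI⟩
    have hl := hL l
    simp only [closedLoop, Sum.elim_inl, B_mulVec_inl] at hl
    rw [hI, loadRow_of_invVoltage] at hl
    exact hl
  · rintro ⟨hR, hI⟩
    refine ⟨fun l => ?_, hI⟩
    simp only [closedLoop, Sum.elim_inl, B_mulVec_inl]
    rw [hI, loadRow_of_invVoltage]
    exact hR l

/-- `B_II + K_I` is invertible as soon as `−(B_II + K_I)` is positive definite (principal
submatrices of `B` are negative definite, `K_i < 0`).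
[cite: SimpsonporcoDorflerBullo2017, Lemma 7.1 (iii) and Proposition 7.2] -/
theorem isUnit_BIIK_det_of_posDef (h : (-W.BIIK).PosDef) : IsUnit W.BIIK.det := by
  have h1 : IsUnit (-W.BIIK).det := (Matrix.isUnit_iff_isUnit_det _).1 h.isUnit
  rw [Matrix.det_neg, isUnit_iff_ne_zero, mul_ne_zero_iff] at h1
  exact isUnit_iff_ne_zero.2 h1.2

/-! ## §3 Theorem 3.3: ZI loads — the unique positive solution `E_L^{ZI}` and the Hurwitz reduced
Jacobian -/

/-- The ZI load model `Q_L^{ZI}(E_L) = [E_L][b_shunt]E_L + [E_L]I_shunt` (constant-impedance and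
constant-current loads). [cite: SimpsonporcoDorflerBullo2017, §3.3 Theorem 3.3 eq. (3.10)] -/
def ziLoad (bsh Ish : Fin n → ℝ) : Fin n → ℝ → ℝ := fun l e => bsh l * e ^ 2 + Ish l * e

variable (W) in
/-- **The high-voltage solution** `E_L^{ZI} = (B_red + [b_shunt])⁻¹(B_redE_L* − I_shunt)`.
[cite: SimpsonporcoDorflerBullo2017, §3.3 Theorem 3.3 eq. (3.11)] -/
def ziVoltage (bsh Ish : Fin n → ℝ) : Fin n → ℝ :=
  (W.Bred + diagonal bsh)⁻¹ *ᵥ (W.redSource - Ish)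

variable (W) in
/-- **The reduced Jacobian** `J_red(E_L) = ∂Q_L/∂E_L(E_L) + [E_L]B_red + [B_red(E_L − E_L*)]` of
the reduced power flow equation, with the load derivative `Q_L'(E_L)` supplied as `dQ`.
[cite: SimpsonporcoDorflerBullo2017, §3.2 Theorem 3.2 eq. (3.9)] -/
def jacRed (dQ EL : Fin n → ℝ) : Matrix (Fin n) (Fin n) ℝ :=
  diagonal dQ + diagonal EL * W.Bred + diagonal (W.Bred *ᵥ EL - W.redSource)

/-- `(−M)⁻¹ = −M⁻¹` for an invertible matrix. [folklore] -/
private theorem inv_neg_eq {ι : Type*} [Fintype ι] [DecidableEq ι] {M : Matrix ι ι ℝ}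
    (hM : IsUnit M.det) : (-M)⁻¹ = -M⁻¹ :=
  Matrix.inv_eq_left_inv (by rw [neg_mul_neg, Matrix.nonsing_inv_mul _ hM])

/-- Invertibility of `M` from positive definiteness of `−M`. [folklore] -/
private theorem isUnit_det_of_posDef_neg {ι : Type*} [Fintype ι] [DecidableEq ι] {M : Matrix ι ι ℝ}
    (h : (-M).PosDef) : IsUnit M.det := by
  have h1 : IsUnit (-M).det := (Matrix.isUnit_iff_isUnit_det _).1 h.isUnit
  rw [Matrix.det_neg, isUnit_iff_ne_zero, mul_ne_zero_iff] at h1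
  exact isUnit_iff_ne_zero.2 h1.2

/-- `E_L^{ZI} = A⁻¹(I_shunt − B_redE_L*)` with `A = −(B_red + [b_shunt])`. [folklore] -/
private theorem ziVoltage_eq {bsh Ish : Fin n → ℝ} (hU : IsUnit (W.Bred + diagonal bsh).det) :
    W.ziVoltage bsh Ish = (-(W.Bred + diagonal bsh))⁻¹ *ᵥ (Ish - W.redSource) := by
  rw [ziVoltage, inv_neg_eq hU, Matrix.neg_mulVec, ← Matrix.mulVec_neg, neg_sub]

/-- **Theorem 3.3, positivity**: if `−(B_red + [b_shunt])` is a Stieltjes matrix (symmetric positive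
definite with nonpositive off-diagonal entries — the print's «`−(B_red + [b_shunt])` is an
`M`-matrix», Berman–Plemmons Ex. 6.2.6) and `I_shunt > B_redE_L*` componentwise, then
`E_L^{ZI} ∈ ℝ^n_{>0}`: `A⁻¹ ≥ 0` entrywise with positive diagonal, applied to a strictly positive
vector. [cite: SimpsonporcoDorflerBullo2017, §3.3 Theorem 3.3 (conditions (i), (ii); «yields a strictly positive vector `E_L^{ZI} ∈ ℝ^n_{>0}`»); BermanPlemmons1994, Ch. 6 Thm. 2.3 (N₃₈), Ex. 2.6] -/
theorem ziVoltage_pos {bsh Ish : Fin n → ℝ} (hA : (-(W.Bred + diagonal bsh)).PosDef)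
    (hZ : IsZMatrix (-(W.Bred + diagonal bsh))) (hI : ∀ l, W.redSource l < Ish l) (l : Fin n) :
    0 < W.ziVoltage bsh Ish l := by
  classical
  set A : Matrix (Fin n) (Fin n) ℝ := -(W.Bred + diagonal bsh) with hAdef
  have hU : IsUnit (W.Bred + diagonal bsh).det := isUnit_det_of_posDef_neg hA
  rw [ziVoltage_eq hU]
  have hinv : ∀ i j, 0 ≤ A⁻¹ i j := posDef_isZMatrix_inv_nonneg hA hZ
  have hdiag : 0 < A⁻¹ l l := hA.inv.diag_pos
  have hv : ∀ j, 0 < Ish j - W.redSource j := fun j => sub_pos.2 (hI j)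
  show 0 < (A⁻¹ *ᵥ (Ish - W.redSource)) l
  simp only [Matrix.mulVec, dotProduct, Pi.sub_apply]
  calc (0 : ℝ) < A⁻¹ l l * (Ish l - W.redSource l) := mul_pos hdiag (hv l)
    _ ≤ ∑ j, A⁻¹ l j * (Ish j - W.redSource j) :=
        Finset.single_le_sum (f := fun j => A⁻¹ l j * (Ish j - W.redSource j))
          (fun j _ => mul_nonneg (hinv l j) (hv j).le) (Finset.mem_univ l)

/-- The reduced power flow residual for ZI loads factors:
`Q_l^{ZI}(E_l) + E_l((B_redE)_l − (B_redE_L*)_l) = E_l(((B_red + [b_shunt])E)_l − (B_redE_L* − I_shunt)_l)`.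
[cite: SimpsonporcoDorflerBullo2017, proof of Theorem 3.3 eq. (3.12) («`0 = [E_L](B_red + [b_shunt])(E_L − E_L^{ZI})`»)] -/
theorem ziResidual_eq (bsh Ish EL : Fin n → ℝ) (l : Fin n) :
    ziLoad bsh Ish l (EL l) + EL l * ((W.Bred *ᵥ EL) l - W.redSource l)
      = EL l * (((W.Bred + diagonal bsh) *ᵥ EL) l - (W.redSource l - Ish l)) := by
  simp only [ziLoad, Matrix.add_mulVec, Pi.add_apply, Matrix.mulVec_diagonal]
  ring

/-- **Theorem 3.3, existence**: `E_L^{ZI}` solves the reduced power flow equation with ZI loads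
(`B_red + [b_shunt]` invertible). [cite: SimpsonporcoDorflerBullo2017, §3.3 Theorem 3.3 and its proof («Observe that `E_L = E_L^{ZI}` is a solution to (3.12)»)] -/
theorem ziVoltage_reducedPowerFlow {bsh Ish : Fin n → ℝ} (hU : IsUnit (W.Bred + diagonal bsh).det) :
    W.ReducedPowerFlow (ziLoad bsh Ish) (W.ziVoltage bsh Ish) := by
  intro l
  rw [ziResidual_eq, ziVoltage, Matrix.mulVec_mulVec, Matrix.mul_nonsing_inv _ hU,
    Matrix.one_mulVec]
  simp only [Pi.sub_apply, sub_self, mul_zero]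

/-- **Theorem 3.3, uniqueness**: a solution of the reduced power flow equation with ZI loads whose
load voltages are all nonzero (in particular a solution in `ℝ^n_{>0}`) IS `E_L^{ZI}`.
[cite: SimpsonporcoDorflerBullo2017, §3.3 Theorem 3.3 («the unique solution `E_L^{ZI} ∈ ℝ^n_{>0}`») and its proof («Since `(B_red + [b_shunt])` is nonsingular and we require that `E_L ∈ ℝ^n_{>0}`, `E_L^{ZI}` is the unique solution»)] -/
theorem eq_ziVoltage_of_reducedPowerFlow {bsh Ish : Fin n → ℝ}
    (hU : IsUnit (W.Bred + diagonal bsh).det) {EL : Fin n → ℝ} (hE : ∀ l, EL l ≠ 0)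
    (h : W.ReducedPowerFlow (ziLoad bsh Ish) EL) : EL = W.ziVoltage bsh Ish := by
  have hlin : (W.Bred + diagonal bsh) *ᵥ EL = W.redSource - Ish := by
    funext l
    have hl := h l
    rw [ziResidual_eq] at hl
    have := (mul_eq_zero.1 hl).resolve_left (hE l)
    rw [Pi.sub_apply]
    linarith
  calc EL = ((W.Bred + diagonal bsh)⁻¹ * (W.Bred + diagonal bsh)) *ᵥ EL := by
        rw [Matrix.nonsing_inv_mul _ hU, Matrix.one_mulVec]
    _ = W.ziVoltage bsh Ish := by rw [← Matrix.mulVec_mulVec, hlin, ziVoltage]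

/-- **The reduced Jacobian at `E_L^{ZI}`** (load derivative `Q_l' = 2b_lE_l + I_l`):
`J_red(E_L^{ZI}) = [E_L^{ZI}](B_red + [b_shunt])`.
[cite: SimpsonporcoDorflerBullo2017, proof of Theorem 3.3 eq. (3.13)] -/
theorem jacRed_ziVoltage {bsh Ish : Fin n → ℝ} (hU : IsUnit (W.Bred + diagonal bsh).det) :
    W.jacRed (fun l => 2 * bsh l * W.ziVoltage bsh Ish l + Ish l) (W.ziVoltage bsh Ish)
      = diagonal (W.ziVoltage bsh Ish) * (W.Bred + diagonal bsh) := by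
  set E := W.ziVoltage bsh Ish with hE
  have hsol : (W.Bred + diagonal bsh) *ᵥ E = W.redSource - Ish := by
    rw [hE, ziVoltage, Matrix.mulVec_mulVec, Matrix.mul_nonsing_inv _ hU, Matrix.one_mulVec]
  have hB : W.Bred *ᵥ E - W.redSource = fun l => -(bsh l * E l) - Ish l := by
    funext l
    have hl := congrFun hsol l
    simp only [Matrix.add_mulVec, Pi.add_apply, Matrix.mulVec_diagonal, Pi.sub_apply] at hl
    simp only [Pi.sub_apply]
    linarith
  rw [jacRed, hB, Matrix.mul_add, Matrix.diagonal_mul_diagonal]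
  ext i j
  simp only [Matrix.add_apply, Matrix.diagonal_apply, Matrix.diagonal_mul]
  split_ifs with h
  · subst h; ring
  · ring

/-- Scaling the rows of a Z-matrix by positive numbers gives a Z-matrix. [folklore] -/
private theorem isZMatrix_diagonal_mul {A : Matrix (Fin n) (Fin n) ℝ} (hZ : IsZMatrix A)
    {d : Fin n → ℝ} (hd : ∀ i, 0 < d i) : IsZMatrix (diagonal d * A) := by
  intro i j hij
  rw [Matrix.diagonal_mul]
  exact mul_nonpos_of_nonneg_of_nonpos (hd i).le (hZ i j hij)

/-- **Theorem 3.3, stability of the reduced Jacobian**: under (i) `−(B_red + [b_shunt])` Stieltjes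
and (ii) `I_shunt > B_redE_L*`, the reduced Jacobian `J_red(E_L^{ZI}) = [E_L^{ZI}](B_red + [b_shunt])`
is Hurwitz («which is Hurwitz since `−(B_red + [b_shunt])` is by assumption an `M`-matrix and
`M`-matrices are `D`-stable»): `[E]A` is a semipositive Z-matrix, hence positive stable
(Berman–Plemmons (I₂₇) ⇒ (G₂₀)).  By the print's Theorem 3.2 (not typed here) this makes the
equilibrium `(E_L^{ZI}, E_I^{ZI})` of the differential-algebraic closed loop locally exponentially
stable. [cite: SimpsonporcoDorflerBullo2017, §3.3 Theorem 3.3 («locally exponentially stable») and its proof (eq. (3.13)); BermanPlemmons1994, Ch. 6 Thm. 2.3 (I₂₇) ⇒ (G₂₀), (N₃₈)] -/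
theorem jacRed_ziVoltage_isHurwitz {bsh Ish : Fin n → ℝ} (hA : (-(W.Bred + diagonal bsh)).PosDef)
    (hZ : IsZMatrix (-(W.Bred + diagonal bsh))) (hI : ∀ l, W.redSource l < Ish l) :
    IsHurwitz (W.jacRed (fun l => 2 * bsh l * W.ziVoltage bsh Ish l + Ish l) (W.ziVoltage bsh Ish)) := by
  classical
  set A : Matrix (Fin n) (Fin n) ℝ := -(W.Bred + diagonal bsh) with hAdef
  set E := W.ziVoltage bsh Ish with hE
  have hUA : IsUnit A.det := (Matrix.isUnit_iff_isUnit_det _).1 hA.isUnit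
  have hU : IsUnit (W.Bred + diagonal bsh).det := isUnit_det_of_posDef_neg hA
  have hEpos : ∀ l, 0 < E l := fun l => ziVoltage_pos hA hZ hI l
  rw [jacRed_ziVoltage hU]
  -- `[E](B_red + [b]) = −([E]A)` with `[E]A` a semipositive Z-matrix
  have hform : diagonal E * (W.Bred + diagonal bsh) = -(diagonal E * A) := by
    rw [hAdef, Matrix.mul_neg, neg_neg]
  rw [hform]
  have hinv : ∀ i j, 0 ≤ A⁻¹ i j := posDef_isZMatrix_inv_nonneg hA hZ
  obtain ⟨u, hu, hAu⟩ := semipositive_of_inv_nonneg hUA hinv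
  have hZ' : IsZMatrix (diagonal E * A) := isZMatrix_diagonal_mul hZ hEpos
  have hAu' : ∀ i, 0 < ((diagonal E * A) *ᵥ u) i := fun i => by
    rw [← Matrix.mulVec_mulVec, Matrix.mulVec_diagonal]
    exact mul_pos (hEpos i) (hAu i)
  exact hZ'.isHurwitz_neg_of_semipositive hu hAu'

/-- **Theorem 3.3 (Stability with "ZI" Loads), assembled.**  Reduced power flow equation with ZI
loads `Q_L^{ZI}(E_L) = [E_L][b_shunt]E_L + [E_L]I_shunt`; assume (i) `−(B_red + [b_shunt])` is an
`M`-matrix — for this symmetric matrix: positive definite with nonpositive off-diagonal entries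
(Stieltjes) — and (ii) `I_shunt > B_redE_L*` componentwise.  Then
`E_L^{ZI} = (B_red + [b_shunt])⁻¹(B_redE_L* − I_shunt)` lies in `ℝ^n_{>0}`, solves the reduced power
flow equation, is its unique solution with positive load voltages, and the reduced Jacobian there,
`[E_L^{ZI}](B_red + [b_shunt])`, is Hurwitz.  MODEL: decoupled reactive power flow `Q = −[E]BE`
(`|θ_i − θ_j| ≈ 0`), inverters as first-order voltage sources with the quadratic droop law, ZI
loads; the DAE stability conclusion («locally exponentially stable») goes through the print's
Theorem 3.2 (linearise the DAE, eliminate the algebraic equations), NOT typed here.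
[cite: SimpsonporcoDorflerBullo2017, §3.3 Theorem 3.3 (conditions (i)–(ii), eq. (3.11), «the unique solution … and the associated equilibrium point … is locally exponentially stable»)] -/
theorem theorem_3_3_ziLoads {bsh Ish : Fin n → ℝ} (hA : (-(W.Bred + diagonal bsh)).PosDef)
    (hZ : IsZMatrix (-(W.Bred + diagonal bsh))) (hI : ∀ l, W.redSource l < Ish l) :
    (∀ l, 0 < W.ziVoltage bsh Ish l) ∧
      W.ReducedPowerFlow (ziLoad bsh Ish) (W.ziVoltage bsh Ish) ∧
      (∀ EL : Fin n → ℝ, (∀ l, 0 < EL l) → W.ReducedPowerFlow (ziLoad bsh Ish) EL →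
        EL = W.ziVoltage bsh Ish) ∧
      IsHurwitz (W.jacRed (fun l => 2 * bsh l * W.ziVoltage bsh Ish l + Ish l)
        (W.ziVoltage bsh Ish)) := by
  have hU : IsUnit (W.Bred + diagonal bsh).det := isUnit_det_of_posDef_neg hA
  exact ⟨ziVoltage_pos hA hZ hI, ziVoltage_reducedPowerFlow hU,
    fun EL hEL h => eq_ziVoltage_of_reducedPowerFlow hU (fun l => (hEL l).ne') h,
    jacRed_ziVoltage_isHurwitz hA hZ hI⟩

/-! ## §4 Proposition 7.2 (i): `−B_red` is a Stieltjes matrix — the sign pattern from the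
inverse-positivity of `−(B_II + K_I)`, positive definiteness from the Schur complement -/

/-- Entries of the blocks. [folklore] -/
private theorem BLL_apply (l l' : Fin n) : W.BLL l l' = W.B (Sum.inl l) (Sum.inl l') := rfl
/-- Entries of the blocks. [folklore] -/
private theorem BLI_apply (l : Fin n) (i : Fin m) : W.BLI l i = W.B (Sum.inl l) (Sum.inr i) := rfl
/-- Entries of the blocks. [folklore] -/
private theorem BIL_apply (i : Fin m) (l : Fin n) : W.BIL i l = W.B (Sum.inr i) (Sum.inl l) := rfl
/-- Entries of the blocks. [folklore] -/
private theorem BII_apply (i i' : Fin m) : W.BII i i' = W.B (Sum.inr i) (Sum.inr i') := rfl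

/-- **Proposition 7.2 (i), sign pattern**: if the off-diagonal entries of `B` are nonnegative
(Lemma 7.1 (i): `B_ij = B_ji ≥ 0` for `i ≠ j`) and `−(B_II + K_I)` is a Stieltjes matrix (a
Z-matrix by (i); positive definite by Lemma 7.1 (iii) and `K_i < 0`), then `−B_red` has nonpositive
off-diagonal entries: `(B_II + K_I)⁻¹ ≤ 0` entrywise (inverse-positivity of Stieltjes matrices), so
`B_LI(B_II + K_I)⁻¹B_IL ≤ 0` entrywise.
[cite: SimpsonporcoDorflerBullo2017, §7 Lemma 7.1 (i), (iii) and Proposition 7.2 (i) («`−B_red` is an `M`-matrix … closure of the set of symmetric positive definite `M`-matrices under the Schur complement»); BermanPlemmons1994, Ch. 6 Thm. 2.3 (N₃₈) and Ex. 5.8 (Schur complement of a nonsingular `M`-matrix)] -/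
theorem isZMatrix_neg_Bred (hoff : ∀ k k', k ≠ k' → 0 ≤ W.B k k') (hII : (-W.BIIK).PosDef) :
    IsZMatrix (-W.Bred) := by
  classical
  have hZII : IsZMatrix (-W.BIIK) := by
    intro i i' hii'
    rw [Matrix.neg_apply, neg_nonpos, BIIK, Matrix.add_apply, BII_apply,
      Matrix.diagonal_apply_ne _ hii', add_zero]
    exact hoff _ _ (by simpa using hii')
  have hUII : IsUnit W.BIIK.det := isUnit_det_of_posDef_neg hII
  have hinv : ∀ i i', W.BIIK⁻¹ i i' ≤ 0 := by
    intro i i'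
    have h := posDef_isZMatrix_inv_nonneg hII hZII i i'
    rw [inv_neg_eq hUII, Matrix.neg_apply] at h
    linarith
  intro l l' hll'
  have hcorr : (W.BLI * W.BIIK⁻¹ * W.BIL) l l' ≤ 0 := by
    rw [Matrix.mul_apply]
    refine Finset.sum_nonpos fun i' _ => mul_nonpos_of_nonpos_of_nonneg ?_ ?_
    · rw [Matrix.mul_apply]
      refine Finset.sum_nonpos fun i _ => mul_nonpos_of_nonneg_of_nonpos ?_ (hinv i i')
      rw [BLI_apply]; exact hoff _ _ (by simp)
    · rw [BIL_apply]; exact hoff _ _ (by simp)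
  have hLL : 0 ≤ W.BLL l l' := by
    rw [BLL_apply]; exact hoff _ _ (by simpa using hll')
  rw [Matrix.neg_apply, Bred, Matrix.sub_apply]
  linarith

/-- For symmetric `B`: `B_ILᵀ = B_LI`, i.e. `B_LIᴴ = B_IL`. [cite: SimpsonporcoDorflerBullo2017, §7 Lemma 7.1 (i) (`B_ij = B_ji`)] -/
theorem BLI_conjTranspose (hB : W.B.IsSymm) : W.BLIᴴ = W.BIL := by
  ext i l
  rw [Matrix.conjTranspose_apply, star_trivial, BLI_apply, BIL_apply]
  exact hB.apply _ _

/-- `B_red` is symmetric when `B` is. [cite: SimpsonporcoDorflerBullo2017, §7 Lemma 7.1 (i) and Proposition 7.2 (i)] -/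
theorem Bred_transpose (hB : W.B.IsSymm) : W.Bredᵀ = W.Bred := by
  have hLL : W.BLLᵀ = W.BLL := by
    ext l l'; rw [Matrix.transpose_apply, BLL_apply, BLL_apply]; exact hB.apply _ _
  have hBII : W.BIIᵀ = W.BII := by
    ext i i'; rw [Matrix.transpose_apply, BII_apply, BII_apply]; exact hB.apply _ _
  have hIIK : W.BIIKᵀ = W.BIIK := by
    rw [BIIK, Matrix.transpose_add, hBII, Matrix.diagonal_transpose]
  have hLI : W.BLIᵀ = W.BIL := by
    rw [← Matrix.conjTranspose_eq_transpose_of_trivial]; exact BLI_conjTranspose hB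
  have hIL : W.BILᵀ = W.BLI := by
    rw [← hLI, Matrix.transpose_transpose]
  rw [Bred, Matrix.transpose_sub, Matrix.transpose_mul, Matrix.transpose_mul, hLL, hIL, hLI,
    Matrix.transpose_nonsing_inv, hIIK, Matrix.mul_assoc]

/-- **Proposition 7.2 (i), definiteness**: if `−(B + blkdiag(0, K_I))` is positive definite (for a
connected network: `−B ⪰ 0` with kernel `𝟙`, Lemma 7.1 (ii), and `K_i < 0`) and `B` is symmetric,
then `−B_red` is positive definite — it is the Schur complement of `−(B + blkdiag(0, K_I))` with
respect to its `II` block.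
[cite: SimpsonporcoDorflerBullo2017, §7 Proposition 7.2 (i) and its proof («`B_red` is the Schur complement of `B + blkdiag(0, K_I)` with respect to the `B_II + K_I` block»); BermanPlemmons1994, Ch. 6 Ex. 5.8] -/
theorem posDef_neg_Bred (hB : W.B.IsSymm)
    (hM : (-(W.B + Matrix.fromBlocks 0 0 0 (diagonal W.K))).PosDef) : (-W.Bred).PosDef := by
  classical
  set M : Matrix (Fin n ⊕ Fin m) (Fin n ⊕ Fin m) ℝ :=
    -(W.B + Matrix.fromBlocks 0 0 0 (diagonal W.K)) with hMdef
  have hLIH := BLI_conjTranspose hB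
  -- `M` in block form
  have hblocks : M = Matrix.fromBlocks (-W.BLL) (-W.BLI) (-W.BLI)ᴴ (-W.BIIK) := by
    rw [Matrix.conjTranspose_neg, hLIH]
    ext k k'
    rcases k with l | i <;> rcases k' with l' | i'
    · simp [hMdef, Matrix.fromBlocks_apply₁₁, BLL_apply]
    · simp [hMdef, Matrix.fromBlocks_apply₁₂, BLI_apply]
    · simp [hMdef, Matrix.fromBlocks_apply₂₁, BIL_apply]
    · simp [hMdef, Matrix.fromBlocks_apply₂₂, BIIK, BII_apply, Matrix.diagonal_apply]
      split_ifs <;> ring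
  -- the `II` block is positive definite, hence invertible and Hermitian
  have hII : (-W.BIIK).PosDef := by
    have h := hM.submatrix Sum.inr_injective
    have hsub : M.submatrix Sum.inr Sum.inr = -W.BIIK := by
      ext i i'
      rw [Matrix.submatrix_apply, hblocks, Matrix.fromBlocks_apply₂₂]
    rw [← hsub]; exact h
  have hUII : IsUnit W.BIIK.det := isUnit_det_of_posDef_neg hII
  obtain ⟨hInv⟩ := hII.isUnit.nonempty_invertible
  -- the Schur complement is `−B_red`
  have hS : -W.BLL - -W.BLI * (-W.BIIK)⁻¹ * (-W.BLI)ᴴ = -W.Bred := by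
    rw [Matrix.conjTranspose_neg, hLIH, inv_neg_eq hUII]
    simp only [Matrix.neg_mul, Matrix.mul_neg, neg_neg, Bred]
    abel
  -- the quadratic form of `−B_red` is that of `M` on `(x, y(x))`
  have hform : ∀ x : Fin n → ℝ, star x ⬝ᵥ ((-W.Bred) *ᵥ x)
      = star (Sum.elim x (-(((-W.BIIK)⁻¹ * (-W.BLI)ᴴ) *ᵥ x)))
          ⬝ᵥ (M *ᵥ Sum.elim x (-(((-W.BIIK)⁻¹ * (-W.BLI)ᴴ) *ᵥ x))) := by
    intro x
    set y : Fin m → ℝ := -(((-W.BIIK)⁻¹ * (-W.BLI)ᴴ) *ᵥ x) with hy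
    rw [Matrix.dotProduct_mulVec, Matrix.dotProduct_mulVec, hblocks,
      Matrix.schur_complement_eq₂₂ (-W.BLL) (-W.BLI) x y hII.1, hS]
    have hzero : ((-W.BIIK)⁻¹ * (-W.BLI)ᴴ) *ᵥ x + y = 0 := by rw [hy]; abel
    rw [hzero, star_zero, Matrix.zero_vecMul, zero_dotProduct, zero_add]
  -- conclude
  rw [Matrix.posDef_iff_dotProduct_mulVec]
  refine ⟨?_, fun x hx => ?_⟩
  · rw [Matrix.IsHermitian, Matrix.conjTranspose_eq_transpose_of_trivial, Matrix.transpose_neg,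
      Bred_transpose hB]
  · rw [hform x]
    refine (Matrix.posDef_iff_dotProduct_mulVec.1 hM).2 fun h0 => hx ?_
    funext l
    exact congrFun h0 (Sum.inl l)

/-- **Proposition 7.2 (i)**: `−B_red` is a Stieltjes matrix (symmetric positive definite Z-matrix —
«an `M`-matrix») for a symmetric susceptance matrix with nonnegative off-diagonal entries and
`−(B + blkdiag(0, K_I))` positive definite; consequently `−(B_red + [b_shunt])` keeps the sign
pattern for every `b_shunt` (hypothesis (i) of Theorem 3.3 is then only about definiteness).
[cite: SimpsonporcoDorflerBullo2017, §7 Proposition 7.2 (i); BermanPlemmons1994, Ch. 6 Def. 2.5, Ex. 2.6, Ex. 5.8] -/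
theorem stieltjes_neg_Bred (hB : W.B.IsSymm) (hoff : ∀ k k', k ≠ k' → 0 ≤ W.B k k')
    (hM : (-(W.B + Matrix.fromBlocks 0 0 0 (diagonal W.K))).PosDef) (bsh : Fin n → ℝ) :
    (-W.Bred).PosDef ∧ IsZMatrix (-W.Bred) ∧ IsZMatrix (-(W.Bred + diagonal bsh)) := by
  classical
  have hII : (-W.BIIK).PosDef := by
    have h := hM.submatrix Sum.inr_injective
    have hsub : (-(W.B + Matrix.fromBlocks 0 0 0 (diagonal W.K))).submatrix Sum.inr Sum.inr
        = -W.BIIK := by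
      ext i i'
      simp [Matrix.submatrix_apply, Matrix.fromBlocks_apply₂₂, BIIK, BII_apply, Matrix.diagonal_apply]
    rw [← hsub]; exact h
  have hZ := isZMatrix_neg_Bred hoff hII
  refine ⟨posDef_neg_Bred hB hM, hZ, fun l l' hll' => ?_⟩
  rw [Matrix.neg_apply, Matrix.add_apply, Matrix.diagonal_apply_ne _ hll', add_zero]
  exact hZ l l' hll'

/-! ## §5 Proposition 7.2 (ii)–(iii): the averaging matrices `W₁`, `W₂` are row-stochastic and the
open-circuit load voltages `E_L* = W₁E_I*` are positive -/

variable (W) in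
/-- The averaging matrix `W₁ = −B_red⁻¹B_LI(B_II + K_I)⁻¹K_I ∈ ℝ^{n×m}`.
[cite: SimpsonporcoDorflerBullo2017, §3.2 eq. (3.5)] -/
def W1 : Matrix (Fin n) (Fin m) ℝ := -(W.Bred⁻¹ * W.BLI * W.BIIK⁻¹ * diagonal W.K)

variable (W) in
/-- The averaging matrix `W₂ = (B_II + K_I)⁻¹(−B_IL  K_I) ∈ ℝ^{m×(n+m)}`.
[cite: SimpsonporcoDorflerBullo2017, §3.2 eq. (3.5)] -/
def W2 : Matrix (Fin m) (Fin n ⊕ Fin m) ℝ := W.BIIK⁻¹ * Matrix.fromCols (-W.BIL) (diagonal W.K)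

variable (W) in
/-- The open-circuit load voltages `E_L* = W₁E_I*`. [cite: SimpsonporcoDorflerBullo2017, §3.2 eq. (3.6)] -/
def ELstar : Fin n → ℝ := W.W1 *ᵥ W.Estar

/-- `B_redE_L* = −B_LI(B_II + K_I)⁻¹K_IE_I*` (= `redSource`) when `B_red` is invertible.
[cite: SimpsonporcoDorflerBullo2017, proof of Theorem 3.1 («`[E_L]B_LI(B_II+K_I)⁻¹K_IE_I^*` … `B_redE_L^*`»)] -/
theorem Bred_mulVec_ELstar (hred : IsUnit W.Bred.det) : W.Bred *ᵥ W.ELstar = W.redSource := by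
  have h1 : W.Bred *ᵥ W.ELstar
      = -((W.Bred * W.Bred⁻¹) *ᵥ ((W.BLI * W.BIIK⁻¹ * diagonal W.K) *ᵥ W.Estar)) := by
    simp only [ELstar, W1, Matrix.neg_mulVec, Matrix.mulVec_neg, Matrix.mulVec_mulVec,
      Matrix.mul_assoc]
  rw [h1, Matrix.mul_nonsing_inv _ hred, Matrix.one_mulVec, redSource]
  simp only [Matrix.mulVec_mulVec, Matrix.mul_assoc]

/-- The inverter voltages of Theorem 3.1 are `W₂(E_L, E_I*)`. [cite: SimpsonporcoDorflerBullo2017, §3.2 eq. (3.8)] -/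
theorem invVoltage_eq_W2_mulVec (EL : Fin n → ℝ) :
    W.invVoltage EL = W.W2 *ᵥ Sum.elim EL W.Estar := by
  rw [W2, ← Matrix.mulVec_mulVec, Matrix.fromCols_mulVec_sumElim, invVoltage, Matrix.neg_mulVec]
  congr 1
  abel

/-- With the reduced power flow equation written through `E_L*`: for `B_red` invertible,
`0 = Q_L(E_L) + [E_L]B_red(E_L − E_L*)` componentwise is `ReducedPowerFlow`.
[cite: SimpsonporcoDorflerBullo2017, §3.2 Theorem 3.1 eq. (3.7)] -/
theorem reducedPowerFlow_iff_ELstar (hred : IsUnit W.Bred.det) (QL : Fin n → ℝ → ℝ)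
    (EL : Fin n → ℝ) :
    W.ReducedPowerFlow QL EL ↔ ∀ l, QL l (EL l) + EL l * (W.Bred *ᵥ (EL - W.ELstar)) l = 0 := by
  simp only [ReducedPowerFlow, Matrix.mulVec_sub, Pi.sub_apply, Bred_mulVec_ELstar hred]

/-- Row sums of `B` split into the load and inverter blocks. [folklore] -/
private theorem rowSum_inl (hrow : ∀ k, ∑ k', W.B k k' = 0) (l : Fin n) :
    (W.BLL *ᵥ fun _ => (1 : ℝ)) l + (W.BLI *ᵥ fun _ => (1 : ℝ)) l = 0 := by
  have h := hrow (Sum.inl l)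
  rw [Fintype.sum_sum_type] at h
  simpa [Matrix.mulVec, dotProduct, BLL_apply, BLI_apply] using h

/-- Row sums of `B` split into the load and inverter blocks. [folklore] -/
private theorem rowSum_inr (hrow : ∀ k, ∑ k', W.B k k' = 0) (i : Fin m) :
    (W.BIL *ᵥ fun _ => (1 : ℝ)) i + (W.BII *ᵥ fun _ => (1 : ℝ)) i = 0 := by
  have h := hrow (Sum.inr i)
  rw [Fintype.sum_sum_type] at h
  simpa [Matrix.mulVec, dotProduct, BIL_apply, BII_apply] using h

/-- **Proposition 7.2 (ii) for `W₂`, row sums**: `W₂𝟙 = 𝟙` when `B` has zero row sums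
(`B𝟙 = 0`, Lemma 7.1 (ii): the kernel of `B` is spanned by `𝟙`) and `B_II + K_I` is invertible.
[cite: SimpsonporcoDorflerBullo2017, §7 Proposition 7.2 (ii) and its proof («it can be verified that … `W₂𝟙 = 𝟙`»)] -/
theorem W2_mulVec_one (hrow : ∀ k, ∑ k', W.B k k' = 0) (hU : IsUnit W.BIIK.det) :
    W.W2 *ᵥ (fun _ => (1 : ℝ)) = fun _ => 1 := by
  have hsplit : (fun _ : Fin n ⊕ Fin m => (1 : ℝ)) = Sum.elim (fun _ => 1) (fun _ => 1) := by
    funext k; cases k <;> rfl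
  have hcols : Matrix.fromCols (-W.BIL) (diagonal W.K) *ᵥ (fun _ : Fin n ⊕ Fin m => (1 : ℝ))
      = W.BIIK *ᵥ fun _ => 1 := by
    rw [hsplit, Matrix.fromCols_mulVec_sumElim]
    funext i
    have h := rowSum_inr hrow i
    simp only [Pi.add_apply, Matrix.neg_mulVec, Pi.neg_apply, BIIK, Matrix.add_mulVec,
      Matrix.mulVec_diagonal, mul_one]
    linarith
  rw [W2, ← Matrix.mulVec_mulVec, hcols, Matrix.mulVec_mulVec, Matrix.nonsing_inv_mul _ hU,
    Matrix.one_mulVec]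

/-- **Proposition 7.2 (ii) for `W₂`, sign**: `W₂ ≥ 0` entrywise when the off-diagonal entries of `B`
are nonnegative, `−(B_II + K_I)` is a Stieltjes matrix and `K_i ≤ 0`.
[cite: SimpsonporcoDorflerBullo2017, §7 Proposition 7.2 (ii); BermanPlemmons1994, Ch. 6 Thm. 2.3 (N₃₈)] -/
theorem W2_nonneg (hoff : ∀ k k', k ≠ k' → 0 ≤ W.B k k') (hII : (-W.BIIK).PosDef)
    (hK : ∀ i, W.K i ≤ 0) (i : Fin m) (k : Fin n ⊕ Fin m) : 0 ≤ W.W2 i k := by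
  classical
  have hZII : IsZMatrix (-W.BIIK) := by
    intro j j' hjj'
    rw [Matrix.neg_apply, neg_nonpos, BIIK, Matrix.add_apply, BII_apply,
      Matrix.diagonal_apply_ne _ hjj', add_zero]
    exact hoff _ _ (by simpa using hjj')
  have hUII : IsUnit W.BIIK.det := isUnit_det_of_posDef_neg hII
  have hinv : ∀ j j', W.BIIK⁻¹ j j' ≤ 0 := by
    intro j j'
    have h := posDef_isZMatrix_inv_nonneg hII hZII j j'
    rw [inv_neg_eq hUII, Matrix.neg_apply] at h
    linarith
  rw [W2, Matrix.mul_apply]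
  refine Finset.sum_nonneg fun j _ => mul_nonneg_of_nonpos_of_nonpos (hinv i j) ?_
  cases k with
  | inl l =>
    rw [Matrix.fromCols_apply_inl, Matrix.neg_apply, neg_nonpos, BIL_apply]
    exact hoff _ _ (by simp)
  | inr i' =>
    rw [Matrix.fromCols_apply_inr, Matrix.diagonal_apply]
    split_ifs
    · exact hK _
    · exact le_rfl

/-- `B_red𝟙 = −B_LI(B_II + K_I)⁻¹K_I𝟙` for zero row sums. [cite: SimpsonporcoDorflerBullo2017, §7 proof of Proposition 7.2 (ii) («`W₁𝟙 = 𝟙`»)] -/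
theorem Bred_mulVec_one (hrow : ∀ k, ∑ k', W.B k k' = 0) (hU : IsUnit W.BIIK.det) :
    W.Bred *ᵥ (fun _ => (1 : ℝ)) = -((W.BLI * W.BIIK⁻¹) *ᵥ (diagonal W.K *ᵥ fun _ => 1)) := by
  -- `B_IL𝟙 = −B_II𝟙 = −(B_II + K_I)𝟙 + K_I`
  have hIL : W.BIL *ᵥ (fun _ => (1 : ℝ))
      = -(W.BIIK *ᵥ fun _ => 1) + diagonal W.K *ᵥ fun _ => 1 := by
    funext i
    have h := rowSum_inr hrow i
    simp only [Pi.add_apply, Pi.neg_apply, BIIK, Matrix.add_mulVec, Matrix.mulVec_diagonal,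
      mul_one]
    linarith
  have hLL : W.BLL *ᵥ (fun _ => (1 : ℝ)) = -(W.BLI *ᵥ fun _ => 1) := by
    funext l
    have h := rowSum_inl hrow l
    rw [Pi.neg_apply]; linarith
  have hsplit : W.Bred *ᵥ (fun _ => (1 : ℝ))
      = W.BLL *ᵥ (fun _ => 1) - (W.BLI * W.BIIK⁻¹) *ᵥ (W.BIL *ᵥ fun _ => 1) := by
    rw [Bred, Matrix.sub_mulVec, Matrix.mulVec_mulVec]
  have h2 : (W.BLI * W.BIIK⁻¹) *ᵥ (W.BIIK *ᵥ fun _ => (1 : ℝ)) = W.BLI *ᵥ fun _ => 1 := by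
    rw [Matrix.mulVec_mulVec, Matrix.mul_assoc, Matrix.nonsing_inv_mul _ hU, Matrix.mul_one]
  rw [hsplit, hIL, Matrix.mulVec_add, Matrix.mulVec_neg, h2, hLL]
  abel

/-- **Proposition 7.2 (ii) for `W₁`, row sums**: `W₁𝟙 = 𝟙` (zero row sums of `B`, `B_II + K_I`
and `B_red` invertible). [cite: SimpsonporcoDorflerBullo2017, §7 Proposition 7.2 (ii) («`W₁𝟙 = 𝟙`»)] -/
theorem W1_mulVec_one (hrow : ∀ k, ∑ k', W.B k k' = 0) (hU : IsUnit W.BIIK.det)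
    (hred : IsUnit W.Bred.det) : W.W1 *ᵥ (fun _ => (1 : ℝ)) = fun _ => 1 := by
  have h1 := Bred_mulVec_one hrow hU
  have h2 : W.W1 *ᵥ (fun _ => (1 : ℝ))
      = -(W.Bred⁻¹ *ᵥ ((W.BLI * W.BIIK⁻¹) *ᵥ (diagonal W.K *ᵥ fun _ => 1))) := by
    simp only [W1, Matrix.neg_mulVec, Matrix.mulVec_mulVec, Matrix.mul_assoc]
  rw [h2, ← Matrix.mulVec_neg, ← h1, Matrix.mulVec_mulVec, Matrix.nonsing_inv_mul _ hred,
    Matrix.one_mulVec]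

/-- **Proposition 7.2 (ii) for `W₁`, sign**: `W₁ ≥ 0` entrywise when `−B_red` and `−(B_II + K_I)`
are Stieltjes matrices, the off-diagonal entries of `B` are nonnegative and `K_i ≤ 0`.
[cite: SimpsonporcoDorflerBullo2017, §7 Proposition 7.2 (ii); BermanPlemmons1994, Ch. 6 Thm. 2.3 (N₃₈)] -/
theorem W1_nonneg (hoff : ∀ k k', k ≠ k' → 0 ≤ W.B k k') (hII : (-W.BIIK).PosDef)
    (hred : (-W.Bred).PosDef) (hZred : IsZMatrix (-W.Bred)) (hK : ∀ i, W.K i ≤ 0)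
    (l : Fin n) (i : Fin m) : 0 ≤ W.W1 l i := by
  classical
  have hZII : IsZMatrix (-W.BIIK) := by
    intro j j' hjj'
    rw [Matrix.neg_apply, neg_nonpos, BIIK, Matrix.add_apply, BII_apply,
      Matrix.diagonal_apply_ne _ hjj', add_zero]
    exact hoff _ _ (by simpa using hjj')
  have hUII : IsUnit W.BIIK.det := isUnit_det_of_posDef_neg hII
  have hUred : IsUnit W.Bred.det := isUnit_det_of_posDef_neg hred
  have hinvII : ∀ j j', W.BIIK⁻¹ j j' ≤ 0 := by
    intro j j'
    have h := posDef_isZMatrix_inv_nonneg hII hZII j j'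
    rw [inv_neg_eq hUII, Matrix.neg_apply] at h
    linarith
  have hinvred : ∀ l l', 0 ≤ (-W.Bred)⁻¹ l l' := posDef_isZMatrix_inv_nonneg hred hZred
  -- `W₁ = (−B_red)⁻¹ B_LI · ((B_II + K_I)⁻¹ K_I)`: a product of two entrywise nonnegative matrices
  have hform : W.W1 = ((-W.Bred)⁻¹ * W.BLI) * (W.BIIK⁻¹ * diagonal W.K) := by
    rw [W1, inv_neg_eq hUred, Matrix.neg_mul, Matrix.neg_mul, Matrix.mul_assoc]
  have hleft : ∀ l j, 0 ≤ ((-W.Bred)⁻¹ * W.BLI) l j := by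
    intro l j
    rw [Matrix.mul_apply]
    refine Finset.sum_nonneg fun l' _ => mul_nonneg (hinvred l l') ?_
    rw [BLI_apply]; exact hoff _ _ (by simp)
  have hright : ∀ j i, 0 ≤ (W.BIIK⁻¹ * diagonal W.K) j i := by
    intro j i
    rw [Matrix.mul_diagonal]
    exact mul_nonneg_of_nonpos_of_nonpos (hinvII j i) (hK i)
  rw [hform, Matrix.mul_apply]
  exact Finset.sum_nonneg fun j _ => mul_nonneg (hleft l j) (hright j i)

/-- **Proposition 7.2 (iii)**: `E_L* > 0` componentwise — each `E_L*,l` is a convex combination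
(`W₁ ≥ 0`, `W₁𝟙 = 𝟙`) of the positive set points `E_i*`.
[cite: SimpsonporcoDorflerBullo2017, §7 Proposition 7.2 (iii) («The proof of (iii) then follows from (ii)»)] -/
theorem ELstar_pos (hW1 : ∀ l i, 0 ≤ W.W1 l i) (hsum : W.W1 *ᵥ (fun _ => (1 : ℝ)) = fun _ => 1)
    (hE : ∀ i, 0 < W.Estar i) (l : Fin n) : 0 < W.ELstar l := by
  classical
  have hrow : ∑ i, W.W1 l i = 1 := by
    have h := congrFun hsum l
    simpa [Matrix.mulVec, dotProduct] using h
  have hne : (Finset.univ : Finset (Fin m)).Nonempty := by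
    rcases isEmpty_or_nonempty (Fin m) with h | h
    · simp at hrow
    · exact Finset.univ_nonempty
  obtain ⟨i₀, -, hmin⟩ := Finset.exists_min_image Finset.univ W.Estar hne
  have hc : 0 < W.Estar i₀ := hE i₀
  calc (0 : ℝ) < W.Estar i₀ := hc
    _ = ∑ i, W.W1 l i * W.Estar i₀ := by rw [← Finset.sum_mul, hrow, one_mul]
    _ ≤ ∑ i, W.W1 l i * W.Estar i :=
        Finset.sum_le_sum fun i _ => mul_le_mul_of_nonneg_left (hmin i (Finset.mem_univ i)) (hW1 l i)
    _ = W.ELstar l := by simp [ELstar, Matrix.mulVec, dotProduct]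

/-- **Proposition 7.2 (Properties of Reduced Quantities), assembled** under Lemma 7.1-type
hypotheses on the data: `B` symmetric with nonnegative off-diagonal entries and zero row sums,
`−(B + blkdiag(0, K_I))` positive definite, `K_i ≤ 0`, `E_i* > 0`.  Then (i) `−B_red` is a
Stieltjes matrix, (ii) `W₁ ≥ 0`, `W₁𝟙 = 𝟙`, `W₂ ≥ 0`, `W₂𝟙 = 𝟙`, (iii) `E_L* > 0`.
[cite: SimpsonporcoDorflerBullo2017, §7 Lemma 7.1 and Proposition 7.2 (i)–(iii)] -/
theorem proposition_7_2 (hB : W.B.IsSymm) (hoff : ∀ k k', k ≠ k' → 0 ≤ W.B k k')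
    (hrow : ∀ k, ∑ k', W.B k k' = 0)
    (hM : (-(W.B + Matrix.fromBlocks 0 0 0 (diagonal W.K))).PosDef) (hK : ∀ i, W.K i ≤ 0)
    (hE : ∀ i, 0 < W.Estar i) :
    ((-W.Bred).PosDef ∧ IsZMatrix (-W.Bred)) ∧
      ((∀ l i, 0 ≤ W.W1 l i) ∧ W.W1 *ᵥ (fun _ => (1 : ℝ)) = fun _ => 1) ∧
      ((∀ i k, 0 ≤ W.W2 i k) ∧ W.W2 *ᵥ (fun _ => (1 : ℝ)) = fun _ => 1) ∧
      ∀ l, 0 < W.ELstar l := by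
  obtain ⟨hred, hZ, -⟩ := stieltjes_neg_Bred hB hoff hM (fun _ => 0)
  have hII : (-W.BIIK).PosDef := by
    have h := hM.submatrix Sum.inr_injective
    have hsub : (-(W.B + Matrix.fromBlocks 0 0 0 (diagonal W.K))).submatrix Sum.inr Sum.inr
        = -W.BIIK := by
      ext i i'
      simp [Matrix.submatrix_apply, Matrix.fromBlocks_apply₂₂, BIIK, BII_apply, Matrix.diagonal_apply]
    rw [← hsub]; exact h
  have hUII : IsUnit W.BIIK.det := isUnit_det_of_posDef_neg hII
  have hUred : IsUnit W.Bred.det := isUnit_det_of_posDef_neg hred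
  have hW1 : ∀ l i, 0 ≤ W.W1 l i := W1_nonneg hoff hII hred hZ hK
  have hW1one := W1_mulVec_one hrow hUII hUred
  exact ⟨⟨hred, hZ⟩, ⟨hW1, hW1one⟩, ⟨W2_nonneg hoff hII hK, W2_mulVec_one hrow hUII⟩,
    ELstar_pos hW1 hW1one hE⟩

/-! ## §6 Back to the original network: the equilibrium `(E_L, W₂(E_L, E_I*))` of the closed loop
and the positive equilibrium `(E_L^{ZI}, E_I^{ZI})` of Theorem 3.3 -/

/-- **Theorem 3.1, (ii) ⇒ (i) without sign conditions**: a solution `E_L` of the reduced power flow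
equation gives the equilibrium `(E_L, W₂(E_L, E_I*))` of the closed loop (3.3) (`B_II + K_I`
invertible). [cite: SimpsonporcoDorflerBullo2017, §3.2 Theorem 3.1 («(ii) Reduced Network: … (3.8)» ⇒ «(i) Original Network») and its proof («each step may be reversed»)] -/
theorem isEquilibrium_of_reducedPowerFlow (hU : IsUnit W.BIIK.det) {QL : Fin n → ℝ → ℝ}
    {EL : Fin n → ℝ} (hR : W.ReducedPowerFlow QL EL) :
    W.IsEquilibrium QL (Sum.elim EL (W.invVoltage EL)) := by
  have hI : W.BIIK *ᵥ W.invVoltage EL = diagonal W.K *ᵥ W.Estar - W.BIL *ᵥ EL := by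
    rw [invVoltage, Matrix.mulVec_mulVec, Matrix.mul_nonsing_inv _ hU, Matrix.one_mulVec]
  funext k
  cases k with
  | inl l =>
    have h := loadRow_of_invVoltage (W := W) EL l
    show QL l (EL l) + EL l * (W.B *ᵥ Sum.elim EL (W.invVoltage EL)) (Sum.inl l) = 0
    have e1 : (fun l' => Sum.elim EL (W.invVoltage EL) (Sum.inl l')) = EL := rfl
    have e2 : (fun i => Sum.elim EL (W.invVoltage EL) (Sum.inr i)) = W.invVoltage EL := rfl
    rw [B_mulVec_inl, e1, e2, h]
    exact hR l
  | inr i =>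
    have hi := congrFun hI i
    simp only [BIIK, Matrix.add_mulVec, Pi.add_apply, Pi.sub_apply, Matrix.mulVec_diagonal] at hi
    simp only [closedLoop, Sum.elim_inr, B_mulVec_inr, Pi.zero_apply, Sum.elim_inl]
    have : W.K i * (W.invVoltage EL i - W.Estar i)
        + ((W.BIL *ᵥ EL) i + (W.BII *ᵥ W.invVoltage EL) i) = 0 := by linarith
    calc W.invVoltage EL i * W.K i * (W.invVoltage EL i - W.Estar i)
          + W.invVoltage EL i * ((W.BIL *ᵥ fun l' => EL l') i
            + (W.BII *ᵥ fun i' => W.invVoltage EL i') i)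
        = W.invVoltage EL i * (W.K i * (W.invVoltage EL i - W.Estar i)
          + ((W.BIL *ᵥ EL) i + (W.BII *ᵥ W.invVoltage EL) i)) := by ring
      _ = 0 := by rw [this, mul_zero]

/-- The recovered inverter voltages are positive when `W₂` is row-stochastic and nonnegative and
`(E_L, E_I*) > 0`: each `E_i = (W₂(E_L, E_I*))_i` is a convex combination of positive numbers.
[cite: SimpsonporcoDorflerBullo2017, §3.2 eq. (3.8) with Proposition 7.2 (ii) («`E_I = W₂(E_L, E_I^*)`», `W₂` row-stochastic)] -/
theorem invVoltage_pos (hW2 : ∀ i k, 0 ≤ W.W2 i k) (hsum : W.W2 *ᵥ (fun _ => (1 : ℝ)) = fun _ => 1)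
    (hE : ∀ i, 0 < W.Estar i) {EL : Fin n → ℝ} (hEL : ∀ l, 0 < EL l) (i : Fin m) :
    0 < W.invVoltage EL i := by
  classical
  rw [invVoltage_eq_W2_mulVec]
  set v : Fin n ⊕ Fin m → ℝ := Sum.elim EL W.Estar with hv
  have hvpos : ∀ k, 0 < v k := by
    intro k; cases k with
    | inl l => exact hEL l
    | inr i' => exact hE i'
  have hrow : ∑ k, W.W2 i k = 1 := by
    have h := congrFun hsum i
    simpa [Matrix.mulVec, dotProduct] using h
  obtain ⟨k₀, -, hmin⟩ :=
    Finset.exists_min_image Finset.univ v (Finset.univ_nonempty_iff.2 ⟨Sum.inr i⟩)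
  calc (0 : ℝ) < v k₀ := hvpos k₀
    _ = ∑ k, W.W2 i k * v k₀ := by rw [← Finset.sum_mul, hrow, one_mul]
    _ ≤ ∑ k, W.W2 i k * v k :=
        Finset.sum_le_sum fun k _ => mul_le_mul_of_nonneg_left (hmin k (Finset.mem_univ k)) (hW2 i k)
    _ = (W.W2 *ᵥ v) i := by simp [Matrix.mulVec, dotProduct]

variable (W) in
/-- The state `(E_L^{ZI}, E_I^{ZI})`, `E_I^{ZI} = W₂(E_L^{ZI}, E_I*)`, of Theorem 3.3.
[cite: SimpsonporcoDorflerBullo2017, §3.3 Theorem 3.3 («the associated equilibrium point `(E_L^{ZI}, E_I^{ZI})` … with `E_I^{ZI} = W₂(E_L^{ZI}, E_I^*)`»)] -/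
def ziState (bsh Ish : Fin n → ℝ) : Fin n ⊕ Fin m → ℝ :=
  Sum.elim (W.ziVoltage bsh Ish) (W.invVoltage (W.ziVoltage bsh Ish))

/-- **Theorem 3.3 in the original network**: under the data hypotheses of Proposition 7.2 (`B`
symmetric, nonnegative off-diagonal entries, zero row sums, `−(B + blkdiag(0, K_I))` positive
definite, `K_i ≤ 0`, `E_i* > 0`) and the hypotheses (i)–(ii) of Theorem 3.3, the state
`(E_L^{ZI}, E_I^{ZI})` is an equilibrium of the closed loop (3.3) with ZI loads, lies in
`ℝ^{n+m}_{>0}`, its load part is the unique positive solution of the reduced power flow equation,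
and the reduced Jacobian there is Hurwitz (whence, by the print's Theorem 3.2 — NOT typed — local
exponential stability of the DAE equilibrium).
[cite: SimpsonporcoDorflerBullo2017, §3.3 Theorem 3.3 and §3.2 Theorems 3.1–3.2, §7 Proposition 7.2] -/
theorem theorem_3_3_originalNetwork {bsh Ish : Fin n → ℝ} (hB : W.B.IsSymm)
    (hoff : ∀ k k', k ≠ k' → 0 ≤ W.B k k') (hrowB : ∀ k, ∑ k', W.B k k' = 0)
    (hM : (-(W.B + Matrix.fromBlocks 0 0 0 (diagonal W.K))).PosDef) (hK : ∀ i, W.K i ≤ 0)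
    (hE : ∀ i, 0 < W.Estar i) (hA : (-(W.Bred + diagonal bsh)).PosDef)
    (hZ : IsZMatrix (-(W.Bred + diagonal bsh))) (hI : ∀ l, W.redSource l < Ish l) :
    W.IsEquilibrium (ziLoad bsh Ish) (W.ziState bsh Ish) ∧
      (∀ k, 0 < W.ziState bsh Ish k) ∧
      (∀ EL : Fin n → ℝ, (∀ l, 0 < EL l) → W.ReducedPowerFlow (ziLoad bsh Ish) EL →
        EL = W.ziVoltage bsh Ish) ∧
      IsHurwitz (W.jacRed (fun l => 2 * bsh l * W.ziVoltage bsh Ish l + Ish l)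
        (W.ziVoltage bsh Ish)) := by
  obtain ⟨-, -, ⟨hW2, hW2one⟩, -⟩ := proposition_7_2 hB hoff hrowB hM hK hE
  obtain ⟨hpos, hsol, huniq, hHur⟩ := theorem_3_3_ziLoads hA hZ hI
  have hII : (-W.BIIK).PosDef := by
    have h := hM.submatrix Sum.inr_injective
    have hsub : (-(W.B + Matrix.fromBlocks 0 0 0 (diagonal W.K))).submatrix Sum.inr Sum.inr
        = -W.BIIK := by
      ext i i'
      simp [Matrix.submatrix_apply, Matrix.fromBlocks_apply₂₂, BIIK, BII_apply, Matrix.diagonal_apply]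
    rw [← hsub]; exact h
  have hU : IsUnit W.BIIK.det := isUnit_det_of_posDef_neg hII
  refine ⟨isEquilibrium_of_reducedPowerFlow hU hsol, fun k => ?_, huniq, hHur⟩
  cases k with
  | inl l => exact hpos l
  | inr i => exact invVoltage_pos hW2 hW2one hE hpos i

end QuadDroopNetwork


/-! ## §7 Lemma 7.1 (Properties of Susceptance Matrix), from network data -/

section Susceptance

variable {ι : Type*} [Fintype ι] [DecidableEq ι]

/-- **Connectivity of a weighted graph, cut form** («connected and weighted graph `G(V, E)`»): every
nonempty proper vertex set has a branch of positive weight leaving it.  General-index twin of the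
tree's `ClassicalModel.CouplingConnected` (stated there for `Fin n`; `branchConnected_iff_couplingConnected`).
[cite: SimpsonporcoDorflerBullo2017, §2.1 («a connected and weighted graph `G(V, E)`»)] -/
def BranchConnected (w : ι → ι → ℝ) : Prop :=
  ∀ S : Finset ι, S.Nonempty → Sᶜ.Nonempty → ∃ i ∈ S, ∃ j ∈ Sᶜ, 0 < w i j

/-- On `Fin n` this is literally `ClassicalModel.CouplingConnected`. [cite: SimpsonporcoDorflerBullo2017, §2.1] -/
theorem branchConnected_iff_couplingConnected {k : ℕ} (w : Fin k → Fin k → ℝ) :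
    BranchConnected w ↔ ClassicalModel.CouplingConnected w := Iff.rfl

/-- **The susceptance matrix of an inductive network** with branch susceptance magnitudes
`w_ij = 1/X_ij ≥ 0` (`w_ij = 0` iff no branch): `B_ij = w_ij` for `i ≠ j`, `B_ii = −Σ_{j≠i} w_ij`
(`Y = jB`, `Y_ij = −y_ij`, `Y_ii = Σ_{j≠i} y_ij` with `y_ij = −j/X_ij`).  The diagonal of `w` is ignored.
[cite: SimpsonporcoDorflerBullo2017, §2.1 («the off-diagonal elements are `Y_ij = Y_ji = −y_ij` … the diagonal elements are given by `Y_ii = Σ_{j≠i} y_ij`», «`Y = jB` … where `B` is the susceptance matrix»)] -/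
def susceptanceMatrix (w : ι → ι → ℝ) : Matrix ι ι ℝ :=
  Matrix.of fun i j => if i = j then -∑ k ∈ Finset.univ.erase i, w i k else w i j

/-- **Lemma 7.1 (i), entries**: `B_ij = w_ij` off the diagonal. [cite: SimpsonporcoDorflerBullo2017, §7 Lemma 7.1 (i)] -/
theorem susceptanceMatrix_apply_ne (w : ι → ι → ℝ) {i j : ι} (hij : i ≠ j) :
    susceptanceMatrix w i j = w i j := by
  rw [susceptanceMatrix, Matrix.of_apply, if_neg hij]

/-- The diagonal entries `B_ii = −Σ_{j≠i} w_ij`. [cite: SimpsonporcoDorflerBullo2017, §2.1 (`Y_ii = Σ_{j≠i} y_ij`)] -/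
theorem susceptanceMatrix_apply_same (w : ι → ι → ℝ) (i : ι) :
    susceptanceMatrix w i i = -∑ k ∈ Finset.univ.erase i, w i k := by
  rw [susceptanceMatrix, Matrix.of_apply, if_pos rfl]

/-- **Lemma 7.1 (i), symmetry**: `B_ij = B_ji` for symmetric branch data.
[cite: SimpsonporcoDorflerBullo2017, §7 Lemma 7.1 (i) («`B_ij = B_ji ≥ 0` for `i ≠ j`»)] -/
theorem susceptanceMatrix_isSymm {w : ι → ι → ℝ} (hw : ∀ i j, w i j = w j i) :
    (susceptanceMatrix w).IsSymm := by
  ext i j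
  rw [Matrix.transpose_apply]
  by_cases h : i = j
  · subst h; rfl
  · rw [susceptanceMatrix_apply_ne w h, susceptanceMatrix_apply_ne w (Ne.symm h), hw]

/-- **Lemma 7.1 (i), sign**: `B_ij ≥ 0` for `i ≠ j`. [cite: SimpsonporcoDorflerBullo2017, §7 Lemma 7.1 (i)] -/
theorem susceptanceMatrix_offDiag_nonneg {w : ι → ι → ℝ} (hw0 : ∀ i j, 0 ≤ w i j) {i j : ι}
    (hij : i ≠ j) : 0 ≤ susceptanceMatrix w i j := by
  rw [susceptanceMatrix_apply_ne w hij]; exact hw0 i j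

/-- **Lemma 7.1 (i), strictness**: for `i ≠ j`, `B_ij > 0` iff `{i, j}` is a branch (`w_ij > 0`).
[cite: SimpsonporcoDorflerBullo2017, §7 Lemma 7.1 (i) («with strict inequality if and only if `{i,j} ∈ E`»)] -/
theorem susceptanceMatrix_offDiag_pos_iff (w : ι → ι → ℝ) {i j : ι} (hij : i ≠ j) :
    0 < susceptanceMatrix w i j ↔ 0 < w i j := by
  rw [susceptanceMatrix_apply_ne w hij]

/-- **Lemma 7.1 (ii), zero row sums**: `B𝟙 = 0`. [cite: SimpsonporcoDorflerBullo2017, §7 Lemma 7.1 (ii) («eigenvalue at zero corresponding to the eigenvector `𝟙`»)] -/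
theorem sum_susceptanceMatrix_row (w : ι → ι → ℝ) (i : ι) : ∑ j, susceptanceMatrix w i j = 0 := by
  rw [← Finset.add_sum_erase _ _ (Finset.mem_univ i), susceptanceMatrix_apply_same]
  have h : ∑ j ∈ Finset.univ.erase i, susceptanceMatrix w i j = ∑ j ∈ Finset.univ.erase i, w i j :=
    Finset.sum_congr rfl fun j hj => susceptanceMatrix_apply_ne w (Finset.ne_of_mem_erase hj).symm
  rw [h]
  ring

/-- `(Bx)_i = −Σ_j w_ij(x_i − x_j)`. [cite: SimpsonporcoDorflerBullo2017, §2.1 eq. (2.3) (`Q_e,i = −E_iΣ_jB_ijE_j`)] -/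
theorem susceptanceMatrix_mulVec (w : ι → ι → ℝ) (x : ι → ℝ) (i : ι) :
    (susceptanceMatrix w *ᵥ x) i = -∑ j, w i j * (x i - x j) := by
  have hsplit : ∀ f : ι → ℝ, ∑ j, f j = f i + ∑ j ∈ Finset.univ.erase i, f j :=
    fun f => (Finset.add_sum_erase _ _ (Finset.mem_univ i)).symm
  simp only [Matrix.mulVec, dotProduct]
  rw [hsplit, hsplit (fun j => w i j * (x i - x j)), susceptanceMatrix_apply_same, sub_self,
    mul_zero, zero_add]
  have h : ∑ j ∈ Finset.univ.erase i, susceptanceMatrix w i j * x j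
      = ∑ j ∈ Finset.univ.erase i, w i j * x j :=
    Finset.sum_congr rfl fun j hj => by rw [susceptanceMatrix_apply_ne w (Finset.ne_of_mem_erase hj).symm]
  rw [h, neg_mul, Finset.sum_mul, ← Finset.sum_neg_distrib, ← Finset.sum_neg_distrib,
    ← Finset.sum_add_distrib]
  exact Finset.sum_congr rfl fun j _ => by ring

/-- **The Laplacian identity** `xᵀBx = −½ΣᵢΣⱼ w_ij(x_i − x_j)²` (symmetric `w`).
[cite: SimpsonporcoDorflerBullo2017, §7 Lemma 7.1 (ii) («`B` is negative semidefinite»)] -/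
theorem dotProduct_susceptanceMatrix_mulVec {w : ι → ι → ℝ} (hw : ∀ i j, w i j = w j i) (x : ι → ℝ) :
    x ⬝ᵥ (susceptanceMatrix w *ᵥ x) = -(1 / 2) * ∑ i, ∑ j, w i j * (x i - x j) ^ 2 := by
  set T : ℝ := ∑ i, ∑ j, w i j * (x i * (x i - x j)) with hT
  have h1 : x ⬝ᵥ (susceptanceMatrix w *ᵥ x) = -T := by
    simp only [hT, dotProduct, susceptanceMatrix_mulVec, mul_neg, Finset.mul_sum, Finset.sum_neg_distrib]
    refine congrArg Neg.neg (Finset.sum_congr rfl fun i _ => Finset.sum_congr rfl fun j _ => by ring)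
  have h2 : T = ∑ i, ∑ j, w i j * (x j * (x j - x i)) := by
    rw [hT, Finset.sum_comm]
    exact Finset.sum_congr rfl fun i _ => Finset.sum_congr rfl fun j _ => by rw [hw j i]
  have h3 : T + T = ∑ i, ∑ j, w i j * (x i - x j) ^ 2 := by
    conv_lhs => rw [h2]; arg 1; rw [← h2]
    rw [hT, ← Finset.sum_add_distrib]
    refine Finset.sum_congr rfl fun i _ => ?_
    rw [← Finset.sum_add_distrib]
    exact Finset.sum_congr rfl fun j _ => by ring
  rw [h1, ← h3]
  ring

/-- **Lemma 7.1 (ii), sign**: `−B` is positive semidefinite (symmetric nonnegative branch data).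
[cite: SimpsonporcoDorflerBullo2017, §7 Lemma 7.1 (ii) («`B` is negative semidefinite»)] -/
theorem posSemidef_neg_susceptanceMatrix {w : ι → ι → ℝ} (hw : ∀ i j, w i j = w j i)
    (hw0 : ∀ i j, 0 ≤ w i j) : (-susceptanceMatrix w).PosSemidef := by
  refine PosSemidef.of_dotProduct_mulVec_nonneg ?_ fun x => ?_
  · rw [IsHermitian, conjTranspose_neg, conjTranspose_eq_transpose_of_trivial,
      (susceptanceMatrix_isSymm hw).eq]
  · rw [star_trivial, neg_mulVec, dotProduct_neg, dotProduct_susceptanceMatrix_mulVec hw]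
    have : 0 ≤ ∑ i, ∑ j, w i j * (x i - x j) ^ 2 :=
      Finset.sum_nonneg fun i _ => Finset.sum_nonneg fun j _ => mul_nonneg (hw0 i j) (sq_nonneg _)
    linarith

/-- On a connected network, equal values across every branch means a constant vector. [folklore] -/
private theorem exists_const_of_branch_eq {w : ι → ι → ℝ} (hconn : BranchConnected w) {x : ι → ℝ}
    (h : ∀ i j, 0 < w i j → x i = x j) : ∃ c : ℝ, x = fun _ => c := by
  classical
  rcases isEmpty_or_nonempty ι with hι | ⟨⟨i₀⟩⟩
  · exact ⟨0, funext fun i => (IsEmpty.false i).elim⟩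
  refine ⟨x i₀, ?_⟩
  by_contra hnot
  have hnot' : ∃ k, x k ≠ x i₀ := by
    by_contra hall
    apply hnot
    funext k
    by_contra hk
    exact hall ⟨k, hk⟩
  obtain ⟨k, hk⟩ := hnot'
  set S : Finset ι := Finset.univ.filter fun i => x i = x i₀ with hS
  have hSne : S.Nonempty := ⟨i₀, by simp [hS]⟩
  have hSc : Sᶜ.Nonempty := ⟨k, by simpa [hS] using hk⟩
  obtain ⟨i, hi, j, hj, hij⟩ := hconn S hSne hSc
  have hi' : x i = x i₀ := by simpa [hS] using hi
  have hj' : ¬ x j = x i₀ := by simpa [hS] using hj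
  exact hj' (by rw [← h i j hij, hi'])

/-- **Lemma 7.1 (ii), kernel**: on a connected network `Bx = 0` iff `x` is constant («a simple
eigenvalue at zero corresponding to the eigenvector `𝟙`»; for the symmetric `B` the geometric
statement typed here is the printed one). [cite: SimpsonporcoDorflerBullo2017, §7 Lemma 7.1 (ii)] -/
theorem susceptanceMatrix_mulVec_eq_zero_iff {w : ι → ι → ℝ} (hw : ∀ i j, w i j = w j i)
    (hw0 : ∀ i j, 0 ≤ w i j) (hconn : BranchConnected w) (x : ι → ℝ) :
    susceptanceMatrix w *ᵥ x = 0 ↔ ∃ c : ℝ, x = fun _ => c := by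
  constructor
  · intro h0
    have hform : ∑ i, ∑ j, w i j * (x i - x j) ^ 2 = 0 := by
      have := dotProduct_susceptanceMatrix_mulVec hw x
      rw [h0, dotProduct_zero] at this
      linarith
    have hterm : ∀ i j, w i j * (x i - x j) ^ 2 = 0 := by
      intro i j
      have hnn : ∀ i j, 0 ≤ w i j * (x i - x j) ^ 2 := fun i j => mul_nonneg (hw0 i j) (sq_nonneg _)
      have hi : ∑ j, w i j * (x i - x j) ^ 2 = 0 :=
        (Finset.sum_eq_zero_iff_of_nonneg (fun i _ => Finset.sum_nonneg fun j _ => hnn i j)).1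
          hform i (Finset.mem_univ i)
      exact (Finset.sum_eq_zero_iff_of_nonneg (fun j _ => hnn i j)).1 hi j (Finset.mem_univ j)
    refine exists_const_of_branch_eq hconn fun i j hij => ?_
    have := hterm i j
    rcases mul_eq_zero.1 this with h | h
    · exact absurd h hij.ne'
    · exact sub_eq_zero.1 (pow_eq_zero_iff (n := 2) (by norm_num) |>.1 h)
  · rintro ⟨c, rfl⟩
    funext i
    rw [susceptanceMatrix_mulVec]
    simp

/-- **Lemma 7.1 (iii)**: every PROPER principal submatrix of `B` is negative definite (connected
network, symmetric nonnegative branch data): a vector supported on a proper vertex subset with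
`xᵀBx = 0` is constant, hence zero.
[cite: SimpsonporcoDorflerBullo2017, §7 Lemma 7.1 (iii) («all principal submatrices of `B` are negative definite»)] -/
theorem posDef_neg_susceptanceMatrix_submatrix {w : ι → ι → ℝ} (hw : ∀ i j, w i j = w j i)
    (hw0 : ∀ i j, 0 ≤ w i j) (hconn : BranchConnected w) {σ : Type*} [Fintype σ] [DecidableEq σ]
    {e : σ → ι} (he : Function.Injective e) (hne : ¬ Function.Surjective e) :
    (-(susceptanceMatrix w).submatrix e e).PosDef := by
  classical
  set B := susceptanceMatrix w with hB
  have hPSD := posSemidef_neg_susceptanceMatrix hw hw0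
  -- extension by zero
  have key : ∀ y : σ → ℝ, star y ⬝ᵥ ((-B.submatrix e e) *ᵥ y)
      = star (Function.extend e y 0) ⬝ᵥ ((-B) *ᵥ Function.extend e y 0) := by
    intro y
    set x : ι → ℝ := Function.extend e y 0 with hx
    have hxe : ∀ s, x (e s) = y s := fun s => he.extend_apply _ _ _
    have hx0 : ∀ i, (¬ ∃ s, e s = i) → x i = 0 := fun i hi => by
      rw [hx, Function.extend_apply' _ _ _ hi, Pi.zero_apply]
    -- both sides as double sums over `σ`
    have hsumι : ∀ f : ι → ℝ, (∀ i, (¬ ∃ s, e s = i) → f i = 0) → ∑ i, f i = ∑ s, f (e s) := by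
      intro f hf
      rw [← Finset.sum_image (f := f) (s := Finset.univ) (g := e) (fun a _ b _ h => he h)]
      refine (Finset.sum_subset (Finset.subset_univ _) fun i _ hi => hf i ?_).symm
      intro ⟨s, hs⟩
      exact hi (Finset.mem_image.2 ⟨s, Finset.mem_univ _, hs⟩)
    simp only [star_trivial, dotProduct, mulVec, Matrix.neg_apply, Matrix.submatrix_apply]
    rw [hsumι (fun i => x i * ∑ j, -B i j * x j) (fun i hi => by rw [hx0 i hi, zero_mul])]
    refine Finset.sum_congr rfl fun s _ => ?_
    rw [hxe s, hsumι (fun j => -B (e s) j * x j) (fun j hj => by rw [hx0 j hj, mul_zero])]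
    refine congrArg _ (Finset.sum_congr rfl fun t _ => ?_)
    rw [hxe t]
  refine PosDef.of_dotProduct_mulVec_pos ?_ fun y hy => ?_
  · -- Hermitian: a principal submatrix of the symmetric `−B`
    have hBH : Bᴴ = B := by
      rw [conjTranspose_eq_transpose_of_trivial, (susceptanceMatrix_isSymm hw).eq]
    rw [IsHermitian, conjTranspose_neg, conjTranspose_submatrix, hBH]
  · rw [key y]
    set x : ι → ℝ := Function.extend e y 0 with hx
    have hxe : ∀ s, x (e s) = y s := fun s => he.extend_apply _ _ _
    have hnn : 0 ≤ star x ⬝ᵥ ((-B) *ᵥ x) := by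
      simpa using hPSD.dotProduct_mulVec_nonneg x
    rcases hnn.lt_or_eq with hpos | hzero
    · exact hpos
    · exfalso
      -- `xᵀBx = 0` with `x ≠ 0` supported away from some vertex: impossible
      have hBx : B *ᵥ x = 0 := by
        -- PSD form vanishes ⇒ in the kernel
        have hq : star x ⬝ᵥ ((-B) *ᵥ x) = 0 := hzero.symm
        have := hPSD.dotProduct_mulVec_zero_iff x |>.1 hq
        rw [neg_mulVec, neg_eq_zero] at this
        exact this
      obtain ⟨c, hc⟩ := (susceptanceMatrix_mulVec_eq_zero_iff hw hw0 hconn x).1 hBx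
      obtain ⟨i₁, hi₁⟩ : ∃ i, ¬ ∃ s, e s = i := not_forall.1 hne
      have hc0 : c = 0 := by
        have := congrFun hc i₁
        rw [hx, Function.extend_apply' _ _ _ hi₁, Pi.zero_apply] at this
        exact this.symm
      apply hy
      funext s
      have := congrFun hc (e s)
      rw [hxe s, hc0] at this
      exact this

end Susceptance

namespace QuadDroopNetwork

variable {n m : ℕ} {W : QuadDroopNetwork n m}

/-- **Consequence for the closed loop's data**: for a connected inductive network, `K_i < 0` and at
least one inverter, `−(B + blkdiag(0, K_I))` is positive definite — the hypothesis of
`posDef_neg_Bred` / `proposition_7_2` (the print's «`B_red` is the Schur complement of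
`B + blkdiag(0, K_I)`», with Lemma 7.1 (ii)–(iii)).
[cite: SimpsonporcoDorflerBullo2017, §7 Lemma 7.1 (ii)–(iii) and proof of Proposition 7.2 (i)] -/
theorem posDef_neg_aug_of_branchConnected {w : Fin n ⊕ Fin m → Fin n ⊕ Fin m → ℝ}
    (hw : ∀ i j, w i j = w j i) (hw0 : ∀ i j, 0 ≤ w i j) (hconn : BranchConnected w)
    (hBw : W.B = susceptanceMatrix w) (hK : ∀ i, W.K i < 0) (hm : 0 < m) :
    (-(W.B + Matrix.fromBlocks 0 0 0 (diagonal W.K))).PosDef := by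
  classical
  have hPSD := posSemidef_neg_susceptanceMatrix hw hw0
  have hKform : ∀ x : Fin n ⊕ Fin m → ℝ,
      x ⬝ᵥ (Matrix.fromBlocks 0 0 0 (diagonal W.K) *ᵥ x) = ∑ i, W.K i * x (Sum.inr i) ^ 2 := by
    intro x
    rw [Matrix.fromBlocks_mulVec, dotProduct, Fintype.sum_sum_type]
    simp only [Sum.elim_inl, Sum.elim_inr, zero_mulVec, Pi.zero_apply, zero_add,
      mulVec_diagonal, Function.comp_apply, mul_zero, Finset.sum_const_zero]
    exact Finset.sum_congr rfl fun i _ => by ring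
  refine PosDef.of_dotProduct_mulVec_pos ?_ fun x hx => ?_
  · have h1 : (-W.B).IsHermitian := by rw [hBw]; exact hPSD.1
    have h2 : (Matrix.fromBlocks (0 : Matrix (Fin n) (Fin n) ℝ) 0 0 (diagonal W.K)).IsHermitian := by
      rw [IsHermitian, Matrix.fromBlocks_conjTranspose]
      simp
    rw [neg_add]
    exact h1.add h2.neg
  · rw [star_trivial, neg_add, add_mulVec, dotProduct_add, neg_mulVec, neg_mulVec, dotProduct_neg,
      dotProduct_neg, hKform]
    have hB0 : 0 ≤ -(x ⬝ᵥ (W.B *ᵥ x)) := by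
      have := hPSD.dotProduct_mulVec_nonneg x
      rw [star_trivial, neg_mulVec, dotProduct_neg] at this
      rwa [hBw]
    have hK0 : 0 ≤ -∑ i, W.K i * x (Sum.inr i) ^ 2 := by
      rw [← Finset.sum_neg_distrib]
      exact Finset.sum_nonneg fun i _ => by nlinarith [hK i, sq_nonneg (x (Sum.inr i))]
    rcases hB0.lt_or_eq with hpos | hzero
    · linarith
    · -- `xᵀBx = 0` ⇒ `x` constant ⇒ the inverter term decides
      have hBx : susceptanceMatrix w *ᵥ x = 0 := by
        have hq : star x ⬝ᵥ ((-susceptanceMatrix w) *ᵥ x) = 0 := by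
          rw [star_trivial, neg_mulVec, dotProduct_neg, ← hBw]; linarith
        have := hPSD.dotProduct_mulVec_zero_iff x |>.1 hq
        rw [neg_mulVec, neg_eq_zero] at this
        exact this
      obtain ⟨c, hc⟩ := (susceptanceMatrix_mulVec_eq_zero_iff hw hw0 hconn x).1 hBx
      have hc0 : c ≠ 0 := by
        rintro rfl
        exact hx (by rw [hc]; rfl)
      have hKpos : 0 < -∑ i, W.K i * x (Sum.inr i) ^ 2 := by
        rw [← Finset.sum_neg_distrib]
        have hi0 : (⟨0, hm⟩ : Fin m) ∈ Finset.univ := Finset.mem_univ _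
        refine lt_of_lt_of_le ?_ (Finset.single_le_sum (fun i _ => ?_) hi0)
        · have : x (Sum.inr ⟨0, hm⟩) = c := congrFun hc _
          rw [this]
          nlinarith [hK ⟨0, hm⟩, sq_pos_of_ne_zero hc0]
        · nlinarith [hK i, sq_nonneg (x (Sum.inr i))]
      linarith

/-- **Theorem 3.3 from network data.**  Connected inductive network (`w` symmetric, `≥ 0`,
`BranchConnected w`, `B = susceptanceMatrix w`), quadratic droop gains `K_i < 0`, set points
`E_i* > 0`, at least one inverter; ZI loads with (i) `−(B_red + [b_shunt])` positive definite (its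
`M`-matrix sign pattern is automatic, §4) and (ii) `I_shunt > B_redE_L*`.  Then `(E_L^{ZI}, E_I^{ZI})`
is an equilibrium of the closed loop (3.3) in `ℝ^{n+m}_{>0}`, `E_L^{ZI}` is the unique positive
solution of the reduced power flow equation, and `J_red(E_L^{ZI})` is Hurwitz.
[cite: SimpsonporcoDorflerBullo2017, §3.3 Theorem 3.3 with §7 Lemma 7.1 and Proposition 7.2] -/
theorem theorem_3_3_of_network {w : Fin n ⊕ Fin m → Fin n ⊕ Fin m → ℝ} {bsh Ish : Fin n → ℝ}
    (hw : ∀ i j, w i j = w j i) (hw0 : ∀ i j, 0 ≤ w i j) (hconn : BranchConnected w)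
    (hBw : W.B = susceptanceMatrix w) (hK : ∀ i, W.K i < 0) (hm : 0 < m) (hE : ∀ i, 0 < W.Estar i)
    (hA : (-(W.Bred + diagonal bsh)).PosDef) (hI : ∀ l, W.redSource l < Ish l) :
    W.IsEquilibrium (ziLoad bsh Ish) (W.ziState bsh Ish) ∧
      (∀ k, 0 < W.ziState bsh Ish k) ∧
      (∀ EL : Fin n → ℝ, (∀ l, 0 < EL l) → W.ReducedPowerFlow (ziLoad bsh Ish) EL →
        EL = W.ziVoltage bsh Ish) ∧
      IsHurwitz (W.jacRed (fun l => 2 * bsh l * W.ziVoltage bsh Ish l + Ish l)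
        (W.ziVoltage bsh Ish)) := by
  have hB : W.B.IsSymm := by rw [hBw]; exact susceptanceMatrix_isSymm hw
  have hoff : ∀ k k', k ≠ k' → 0 ≤ W.B k k' := fun k k' hkk' => by
    rw [hBw]; exact susceptanceMatrix_offDiag_nonneg hw0 hkk'
  have hrowB : ∀ k, ∑ k', W.B k k' = 0 := fun k => by rw [hBw]; exact sum_susceptanceMatrix_row w k
  have hM := posDef_neg_aug_of_branchConnected hw hw0 hconn hBw hK hm
  obtain ⟨-, -, hZ⟩ := stieltjes_neg_Bred hB hoff hM bsh
  exact theorem_3_3_originalNetwork hB hoff hrowB hM (fun i => (hK i).le) hE hA hZ hI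

end QuadDroopNetwork

end Literature.MathematicalPhysics.PowerSystems

end
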